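import Summits.AtomisticToContinuum.HydrodynamicLimit.Theses.JParityClosure
import Summits.AtomisticToContinuum.HydrodynamicLimit.Theorems.LocalSecondLaw.Negative.Functional
import Summits.AtomisticToContinuum.HydrodynamicLimit.Theorems.LocalSecondLaw.Negative.FalseWithoutLLN
import Summits.AtomisticToContinuum.HydrodynamicLimit.Theorems.LocalSecondLaw.Negative.FalseWithoutSupport
import Summits.AtomisticToContinuum.HydrodynamicLimit.Theorems.LocalSecondLaw.Negative.Tightness
import Summits.AtomisticToContinuum.HydrodynamicLimit.Theorems.LocalSecondLaw.Negative.RAfterN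
import Summits.AtomisticToContinuum.HydrodynamicLimit.Theorems.ImplosionDichotomyHsEosLowDensity
import Literature.MathematicalPhysics.KineticTheory.EvenCollisionTubeFunctional

/-!
# Line `resibois-offset-identity` — crux `JParityClosure.LocalSecondLaw` (stmt-AtomisticToContinuum-13081)

Checked skeleton (crux-plan, planner-cruxplan-stmt-AtomisticToContinuum-13081-resibois-offset-iden-0,
2026-08-16) of the crux idea `Cruxes/LocalSecondLaw/Ideas/resibois-offset-identity.md` (ideator 2, round 1;
typed backbone `Cruxes/LocalSecondLaw/IdeatorTwoSketch.lean`, `OffsetIsConfigurational`), sharpened by the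
round-1 triage panel (`TRIAGE-r1-{1,2,3}.md`: pass ×3 — "support-type card: the configurational part of 13081
collapses onto `EvenStressEnskog` (13079) + one J-even mark family with Enskog target 0 + Maxwellisation; state
it inside the band; fold into the picked line").  Line card: `Cruxes/LocalSecondLaw/Lines/resibois-offset-identity.md`.

THE LINE (direction POSITIVE; `LocalSecondLaw_of` concludes the route decl BY NAME).  Write the crux functional
`D = I + I_Eul` (`I = entropyFunctional`, the crux's `let`-tower by name, `Theorems/LocalSecondLaw/Negative/
Functional.lean`; `I_Eul = ∫ H(ρ(0),θ(0)) φ(0)` the Euler boundary term).  Along ONE trajectory the exact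
entropy bookkeeping of the `(r,ϑ)`-mollified empirical one-body law `h = hm` splits the collisional change of the
kinetic entropy into the φ-weighted, cone-smeared surprisal drops of the two partners, each read around ITS OWN
position (`jump2`, two-point) — and `jump2 = jump1 + (jump2 − jump1)`: `jump1` reads both partners around `xᵢ`
(the route's one-point, J-odd jump `F`, smeared), the OFFSET `jump2 − jump1` reads partner `j` once around
`x_j = x_i − ε n̂` and once around `x_i`.  The offset is `O(ε)` per collision but is summed `Kn⁻¹` times per unit
time: `εν ≍ σ³` — it is Enskog's collisional-TRANSFER channel and the home of the configurational entropy
`H_C = ρ f_ex(ρσ³)`.  Résibois' thermodynamic consistency (`Y = (3/2π) f_ex′`, the route's contact value) makes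
the per-unit-time offset functional `P2 − P1` cancel the weak material derivative of `H_C(ρ_r)` EXACTLY at
Euler precision (idea card; Taylor step, Gaussian identities (α) `E[a₊²] = θ`, `∫ n̂⊗n̂ = (4π/3)𝟙` and (β)
`E[a₊(2a c_w·n̂ − a²)] = 0` re-derived by all three triagers).  Hence, with
`kinFunctional := entropyFunctional − confFunctional` (the ideal-gas part of `I`, DEFINED as the difference so
that the split is `sub_add_cancel`, no integrability in the glue):

  D = [kinF + initKin − P2]  +  [(P2 − P1) + confF + initConf]  +  P1  +  [I_Eul − initKin − initConf]
        ≥ −η/4 (K)               |·| ≤ η/4 (O, this card)        ≥ −η/4 (S)   |·| ≤ η/4 (I)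

on the regularity event `Regular` (density floor/band, temperature floor, energy cap at resolution `r`, uniformly
on `[0,τ] × 𝕋³`; law of its failure `≤ δ/5` by R), each bad event having law `≤ δ/5`: a five-set union bound.

REGISTERED STUBS (the only `sorry`s; statement `Prop`s `Stubs.stub_*` with the same text):
* R `stub_floors` — REGULARITY FLOORS at fixed `r`, all `τ`, local-Gibbs frame (hygiene; L/open).
* M `stub_maxwellisation` — `OddContactSymmetry → RateFloor → CollisionTightness → EmpiricalEnskogIdentity →`
  ENTROPIC MAXWELLISATION: the time-integrated relative entropy of `hm` w.r.t. its own local Maxwellian → 0 in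
  probability on `Regular` (card `production-currency` (ii-a), endorsed by all three triagers at the `K_N`
  level; L/XL; the single chaos-type input of the kinetic side, bought from cruxes 2 and 4 BY NAME).
* K `stub_kineticBalance` — `CollisionTightness → MaxwellisationStatement →` KINETIC ENTROPY BALANCE in the crux's convective weak
  form: `kinF + initKin ≥ P2 − η` w.h.p. on `Regular` (exact pathwise `H_K`-balance + convexity + streaming
  commutator `O(ϑ²)` + cold spots + entropy VALUE Maxwellisation + the CONDUCTIVE kinetic entropy flux
  `∫(v − u_r) h log h dv → 0` in weak form — the hidden weak CUBIC closure (N1) the triage found NECESSARY; XL).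
* S `stub_netProduction` — `CollisionTightness →` LOCAL NET PRODUCTION (card `kinetic-supersolution-kn-budget`'s `LocalNetProduction`,
  SMEARED one-point form as triage r1-1 (3) asks for all-`τ` fidelity): the per-unit-time net one-point
  surprisal production `P1 ≥ −η` w.h.p. — THE kinetic bet; unsplit, immune to the fixed-`r` mixture rock (M);
  pre-shock `→ 0`, post-shock the panel's shock quadrature gives the right sign and size (L/open).
* Θ `stub_sTransfer` — the card's TRANSFER `C⁺` minus what is filed: `EvenStressEnskog` (13079) FOR ONE MORE
  J-EVEN MARK FAMILY `Ξ_S^k = ((w−v)·n̂)₊((v+w)·n̂) n̂_k` (quadratic in velocities), crux-3 frame verbatim over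
  the tree's `evenStat` (its Enskog target `B_r(Ξ_S)` is `2θ̃(4π/3)ρ²u_k` at a Maxwellian and cancels against
  `−2u_m B_r(Ξ_P^{mk})` — identity (β); open-problem, crux-3 class).
* O `stub_offset` — `EvenStressEnskog → CollisionTightness → HsEosLowDensity → SStatement → MaxwellisationStatement →` OFFSET IS
  CONFIGURATIONAL: `|(P2 − P1) + confF + initConf| ≤ η` w.h.p. on `Regular` inside the band (THIS CARD'S LEVER;
  layer-2 inside: finite-difference/Taylor step in the cone centre, net step for configuration-dependent weights
  `φ∂u_r/θ̃_r`, `φ u_r ∂θ̃_r/θ̃_r²`, `φ∂θ̃_r/θ̃_r²` (cone fields are `r⁻⁴`-Lipschitz on `Regular`), Gaussian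
  identities (α)/(β), the renormalised-continuity WORK IDENTITY `confF + initConf = σ³∫∫φ ρ_r² f_ex′ div u_r`
  (exact continuity of the cone density), `O(ε/r) + O(r²) + O((N r³ϑ³)^{−1/2})` errors; L given its antecedents).
* I `stub_init` — `HsEosLowDensity →` INITIAL MATCHING at `t = 0`: `|initKin + initConf − I_Eul| ≤ η` w.h.p. —
  the ONLY place the `t = 0` law of large numbers and the Euler data enter (M/L, provable now: static LLN under
  the local Gibbs law + Gaussian entropy algebra + continuity of `f_ex` on the band).

`LocalSecondLaw_of : OddContactSymmetry → EvenStressEnskog → RateFloor → CollisionTightness →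
EmpiricalEnskogIdentity → HsEosLowDensity → R → M → K → S → Θ → O → I → LocalSecondLaw` is PROVED below (no
`sorry`): thresholds `η₁ := min ηK ηO` (band level fed to R), `σ₀ := min` of five, floors from R after `τ`,
`r₀ := min` of five, `ϑ := r₀/2` (the crux has no velocity mollifier: `ϑ` is internal to the line), `N₀ := max`,
`change` to the named functional, `sub_add_cancel`, union bound.  So THIS LINE PROVES CRUX 5 FROM CRUXES 2, 3, 4
(+ supports 13085, 13086, 0768) AND SEVEN LEMMAS — the triage's structural finding ("pre-shock 13081 is not
independent of cruxes 2–4 except for the heat currents") made kernel-checked; `HsEosLowDensity` is moreover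
PROVED in the tree (`Theorems.hsEosLowDensity_proof`), see `LocalSecondLaw_of'`.

REACH / FIDELITY.  The crux is typed for ALL `τ > 0` (no `τ < T`; Disproof fidelity note, all three triagers).
The crux is FIXED for this seat, so every stub is typed all-`τ` exactly as the crux demands; the stubs whose
post-`T` truth is a bet WITHOUT mechanism are S (sign of the net production through shocks — passes the panel's
Mach 1.2–8 quadrature), K's conductive-flux piece and O's/Θ's contact values across a shock layer (volume fraction
`O(r)` of `O(1)`-normalised statistics — absorbed by `r → 0` only if no `O(1/r)` concentration), and R (no
packing pocket / vacuum pocket / cold spot of size `r` ever).  Planner message carried in the line card: re-filing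
`C′ = (τ < T →) LocalSecondLaw` (what `ParityInBand` consumes) turns the band part of R into `DensityCap ∧
DiluteSelfConsistency` and removes the post-shock bets (S stays as the only signed statement, pre-shock nearly free:
net production `O(Kn) → 0`).

DISPROOF USED (`Cruxes/LocalSecondLaw/Disproof.lean`, 2026-08-16T02:29Z, verdict NO KILL; landed under
`Theorems/LocalSecondLaw/Negative/`, imported here): `localSecondLaw_false_without_lln` — honoured: the `t = 0`
LLN is consumed by `stub_init` and ONLY there (the Euler datum `H(ρ(0),θ(0))` is matched to `initKin + initConf`);
`localSecondLaw_false_without_support` — honoured: K and O carry the support hypothesis `∃ τ' < τ, φ = 0 after τ'`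
(no final-time boundary term); `not_localSecondLawGapAt` / `not_localSecondLawStrictGap` (tight at equilibrium) —
respected: every stub is an `η`-approximate statement, and at global equilibrium `P1, P2 − P1, confF + initConf`
all vanish separately (no gap is produced anywhere); `not_localSecondLawRAfterN` — respected: every stub keeps
`∃ r₀ ∀ r ϑ < r₀ ∃ N₀ ∀ N ≥ N₀` (`N r³ → ∞` centres per ball; R's floors are exactly the "temperature content"
the junk order loses); §(b) cold-ball divergence — quarantined by R's temperature floor (on `Regular` the
`ϑ`-shift `(3/2)ρ_r log(1 + ϑ²/θ_r) ≤ (3/2)ρ_r ϑ²/θ₁`); §(d) continuity of `f_ex` — `HsEosLowDensity` is an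
antecedent of O and I (and is proved in the tree).  Sibling `Cruxes/OddContactSymmetry/Disproof.lean` §3/§3c
(mixture / anisotropic mollifier breaks twisted balance = the triage's fixed-`r` rock (M)) — respected: NO stub
bounds one half of the `F`-split at the `ε⁻¹` level; P1, P2 are NET (unsplit) statistics and `P2 − P1` is the
`O(ε)`-offset, all `O(1)`-normalised.  Negatives index (`ledger negatives`, 12, read 2026-08-16): 9168 (unguarded
`∃σ₀ ∀`-solution frame feeding a junk EOS branch) — no stub quantifies over Euler solutions except I, which uses
only the `t = 0` slice tied by the LLN; 9236/9238 (small cells at finite `N`) — `N → ∞` first everywhere; 14607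
(exponential velocity moments) — all marks here are at most quadratic in velocities; 13479 unrelated.
-/

set_option linter.unusedVariables false

noncomputable section

namespace Summit.AtomisticToContinuum.HydrodynamicLimit.Cruxes.LocalSecondLaw.ResiboisOffsetIdentity

open scoped BigOperators Topology Classical MeasureTheory ENNReal InnerProductSpace
open Filter Set MeasureTheory
open Literature.MathematicalPhysics.KineticTheory
open Literature.Analysis.FluidPDE
open Summit.AtomisticToContinuum.HydrodynamicLimit.Theses.JParityClosure
open Summit.AtomisticToContinuum.HydrodynamicLimit.Theorems.LocalSecondLawNegative

/-! ## Vocabulary (local; definition request filed to move it verbatim into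
`Literature/MathematicalPhysics/KineticTheory/` like `CollisionTubeFunctional.lean`)

All functionals are explicit real-valued functions of ONE configuration (or of a flow and an initial datum),
built from the tree's prelude: `cone`/`rhoC`/`momC`/`kinC`/`thetaC`/`Hs`/`entropyFunctional`
(`Theorems/LocalSecondLaw/Negative/Functional.lean`, definitionally the crux's `let`-tower), `empiricalMeasure`,
`localMaxwellian`, `reflectVel`, `collisionTimes`, `Torus.geometry`/`sepVec`, `hsDiameter`, `hsExcessFreeEnergy`,
`localGibbsLaw`, and `evenStat` (`EvenCollisionTubeFunctional.lean`, the crux-3 statistic for a general mark). -/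

variable {N : ℕ}

/-- The `(r,ϑ)`-mollified empirical one-body law `h(x₀,v) = ∫ b_r(y,x₀) G_ϑ(v − w) dμ_z(y,w)` (cone kernel in
space, Gaussian of variance `ϑ²` in velocity; verbatim the `hm` of `OddContactSymmetry` at one configuration).
Mass `ρ_r(x₀)`, momentum `m_r(x₀)`, kinetic energy `e_r(x₀) + (3/2)ϑ²ρ_r(x₀)`. -/
def hm (r ϑ : ℝ) (z : Config (N + 1) (Fin 3) T3) (x₀ : T3) (v : V3) : ℝ :=
  ∫ q, cone r q.1 x₀ * localMaxwellian 1 (ϑ ^ 2) v q.2 ∂(empiricalMeasure z)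

/-- Kinetic entropy density `h_kin(x₀) = ∫ h log h dv` of the mollified law (Boltzmann's `H` density). -/
def hkin (r ϑ : ℝ) (z : Config (N + 1) (Fin 3) T3) (x₀ : T3) : ℝ :=
  ∫ v, hm r ϑ z x₀ v * Real.log (hm r ϑ z x₀ v)

/-- Empirical velocity `u_r = m_r / ρ_r` (junk `0` where `ρ_r = 0`). -/
def uC (r : ℝ) (z : Config (N + 1) (Fin 3) T3) (x₀ : T3) : V3 :=
  (rhoC r z x₀)⁻¹ • momC r z x₀

/-- Relative entropy of `h(x₀,·)` with respect to ITS OWN local Maxwellian (same mass `ρ_r`, velocity `u_r` and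
smoothed temperature `θ_r + ϑ²`): `∫ h log (h / M[h]) dv = h_kin − ∫ M[h] log M[h] ≥ 0`. -/
def klMaxwell (r ϑ : ℝ) (z : Config (N + 1) (Fin 3) T3) (x₀ : T3) : ℝ :=
  ∫ v, hm r ϑ z x₀ v *
    Real.log (hm r ϑ z x₀ v / localMaxwellian (rhoC r z x₀) (thetaC r z x₀ + ϑ ^ 2) (uC r z x₀) v)

/-- Configurational entropy density `H_C(a) = a · f_ex(a σ³)` (unguarded; `= Hs − H_id` on `{ρ > 0, θ > 0}`). -/
def HC (σ a : ℝ) : ℝ := a * hsExcessFreeEnergy (a * σ ^ 3)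

/-- `c₀ = (3/2)(log 2π + 1)`: for a Maxwellian `∫ M log M dv = ρ log ρ − (3/2) ρ log θ − c₀ ρ = H_id(ρ,θ) − c₀ρ`. -/
def c0 : ℝ := 3 / 2 * (Real.log (2 * Real.pi) + 1)

/-- The CONE-SMEARED, `φ`-WEIGHTED SURPRISAL DROP of one particle whose velocity jumps `w⁻ → w⁺`, read with the
cone centred at `y`: `∫ b_r(y,x) φ(x) ∫ [G_ϑ(v − w⁻) − G_ϑ(v − w⁺)] log h(x,v) dv dx`.  It is `(N+1)×` minus the
linearisation of the jump of `∫∫ φ h log h` caused by moving that particle's Gaussian, i.e. the literal collision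
term of the exact kinetic-entropy balance (triage r1-1 (S)(i)). -/
def sDrop (r ϑ : ℝ) (φs : T3 → ℝ) (z : Config (N + 1) (Fin 3) T3) (y : T3) (wpre wpost : V3) : ℝ :=
  ∫ x, cone r y x * φs x *
    ∫ v, (localMaxwellian 1 (ϑ ^ 2) wpre v - localMaxwellian 1 (ϑ ^ 2) wpost v) * Real.log (hm r ϑ z x v)

/-- Pre-collisional velocities of the ordered pair `(i, j)` recovered from the (right-continuous,
post-collisional) configuration by the involution `reflectVel` (the route's `pv`). -/
def preVel (w : Config (N + 1) (Fin 3) T3) (i j : Fin (N + 1)) : V3 × V3 :=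
  reflectVel ((Torus.geometry (Fin 3)).sepVec (w i).1 (w j).1) ((w i).2, (w j).2)

/-- ONE-POINT smeared surprisal jump of the ordered contact pair `(i,j)`: BOTH partners' drops read around `xᵢ`
(the cone-smeared form of the route's J-odd surprisal jump `F`). -/
def jump1 (r ϑ : ℝ) (φs : T3 → ℝ) (w : Config (N + 1) (Fin 3) T3) (i j : Fin (N + 1)) : ℝ :=
  sDrop r ϑ φs w (w i).1 (preVel w i j).1 (w i).2 + sDrop r ϑ φs w (w i).1 (preVel w i j).2 (w j).2

/-- TWO-POINT smeared surprisal jump: each partner's drop read around ITS OWN position (`x_j = x_i − ε n̂`); the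
exact first-order jump of the kinetic entropy.  `jump2 − jump1` is the Enskog OFFSET (`O(ε)` per collision). -/
def jump2 (r ϑ : ℝ) (φs : T3 → ℝ) (w : Config (N + 1) (Fin 3) T3) (i j : Fin (N + 1)) : ℝ :=
  sDrop r ϑ φs w (w i).1 (preVel w i j).1 (w i).2 + sDrop r ϑ φs w (w j).1 (preVel w i j).2 (w j).2

/-- The PER-UNIT-ENTROPY collision sum `(2(N+1))⁻¹ Σ_{collision times s ∈ [0,τ]} Σ_{ordered contact pairs} m`
along `s ↦ Φ.flow s z` — the route's `K_N = Kc` with its Euler weight `ε/(N+1)` replaced by `1/(2(N+1))`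
(`= (2ε)⁻¹ K_N`, the normalisation of an entropy BALANCE: a symmetric mark summed once per collision with weight
`(N+1)⁻¹`).  Junk `0` for infinitely many collision times (off the good set). -/
def prodSum (σ : ℝ) (N : ℕ) (Φ : HardSphereFlow (Torus.geometry (Fin 3)) (hsDiameter σ N) (N + 1)) (τ : ℝ)
    (m : Config (N + 1) (Fin 3) T3 → ℝ → Fin (N + 1) → Fin (N + 1) → ℝ)
    (z : Config (N + 1) (Fin 3) T3) : ℝ :=
  (2 * ((N : ℝ) + 1))⁻¹ *
    ∑ᶠ (s : ℝ) (_ : s ∈ collisionTimes (Torus.geometry (Fin 3)) (hsDiameter σ N) (fun s' => Φ.flow s' z) ∩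
        Set.Icc 0 τ),
      ∑ i : Fin (N + 1), ∑ j : Fin (N + 1),
        (if i ≠ j ∧ ‖(Torus.geometry (Fin 3)).sepVec (Φ.flow s z i).1 (Φ.flow s z j).1‖ = hsDiameter σ N then
          m (Φ.flow s z) s i j
        else 0)

/-- `P1` — one-point NET surprisal production functional (per unit entropy, `φ`-weighted, cone-smeared). -/
def P1 (σ : ℝ) (N : ℕ) (Φ : HardSphereFlow (Torus.geometry (Fin 3)) (hsDiameter σ N) (N + 1))
    (τ r ϑ : ℝ) (φ : ℝ → T3 → ℝ) (z : Config (N + 1) (Fin 3) T3) : ℝ :=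
  prodSum σ N Φ τ (fun w s i j => jump1 r ϑ (φ s) w i j) z

/-- `P2` — two-point NET surprisal production functional (the literal collision term of the kinetic balance). -/
def P2 (σ : ℝ) (N : ℕ) (Φ : HardSphereFlow (Torus.geometry (Fin 3)) (hsDiameter σ N) (N + 1))
    (τ r ϑ : ℝ) (φ : ℝ → T3 → ℝ) (z : Config (N + 1) (Fin 3) T3) : ℝ :=
  prodSum σ N Φ τ (fun w s i j => jump2 r ϑ (φ s) w i j) z

/-- `confF` — the CONFIGURATIONAL part of the crux functional: `∫₀^τ∫ H_C(ρ_r)(∂ₛφ + u_r·∇φ) dx ds`. -/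
def confFunctional (σ r τ : ℝ) (φ : ℝ → T3 → ℝ)
    (Φ : HardSphereFlow (Torus.geometry (Fin 3)) (hsDiameter σ N) (N + 1)) (z : Config (N + 1) (Fin 3) T3) : ℝ :=
  ∫ s in Set.Icc (0 : ℝ) τ, ∫ x : T3,
    HC σ (rhoC r (Φ.flow s z) x) *
      (deriv (fun s' => φ s' x) s +
        ∑ k : Fin 3, (momC r (Φ.flow s z) x) k / rhoC r (Φ.flow s z) x *
          Literature.Analysis.FunctionSpaces.Torus.partialDeriv k (φ s) x)

/-- `kinF := I − confF` — the KINETIC (ideal-gas) part of the crux functional `I = entropyFunctional`, DEFINED as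
the difference (on `Regular ∩ good` it is `∫₀^τ∫ H_id(ρ_r,θ_r)(∂ₛφ + u_r·∇φ)`, `H_id(a,b) = −a(3/2 log b − log a)`:
`Hs = H_id + H_C` pointwise on `{ρ > 0, θ > 0}` and both halves are integrable there — bookkeeping that belongs to
the prover of `stub_kineticBalance`, not to the glue). -/
def kinFunctional (σ r τ : ℝ) (φ : ℝ → T3 → ℝ)
    (Φ : HardSphereFlow (Torus.geometry (Fin 3)) (hsDiameter σ N) (N + 1)) (z : Config (N + 1) (Fin 3) T3) : ℝ :=
  entropyFunctional σ r τ φ Φ z - confFunctional σ r τ φ Φ z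

/-- `initKin` — empirical KINETIC boundary term at `s = 0`: `∫ (h_kin + c₀ρ_r)(0,x) φ(0,x) dx`. -/
def initKin (σ r ϑ : ℝ) (φ : ℝ → T3 → ℝ)
    (Φ : HardSphereFlow (Torus.geometry (Fin 3)) (hsDiameter σ N) (N + 1)) (z : Config (N + 1) (Fin 3) T3) : ℝ :=
  ∫ x : T3, (hkin r ϑ (Φ.flow 0 z) x + c0 * rhoC r (Φ.flow 0 z) x) * φ 0 x

/-- `initConf` — empirical CONFIGURATIONAL boundary term at `s = 0`: `∫ H_C(ρ_r(0,x)) φ(0,x) dx`. -/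
def initConf (σ r : ℝ) (φ : ℝ → T3 → ℝ)
    (Φ : HardSphereFlow (Torus.geometry (Fin 3)) (hsDiameter σ N) (N + 1)) (z : Config (N + 1) (Fin 3) T3) : ℝ :=
  ∫ x : T3, HC σ (rhoC r (Φ.flow 0 z) x) * φ 0 x

/-- `klF` — time–space integrated relative entropy of the mollified law w.r.t. its own local Maxwellian. -/
def klFunctional (σ r ϑ τ : ℝ)
    (Φ : HardSphereFlow (Torus.geometry (Fin 3)) (hsDiameter σ N) (N + 1)) (z : Config (N + 1) (Fin 3) T3) : ℝ :=
  ∫ s in Set.Icc (0 : ℝ) τ, ∫ x : T3, klMaxwell r ϑ (Φ.flow s z) x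

/-- The REGULARITY EVENT at resolution `r` on `[0,τ] × 𝕋³`: density floor `ρ₁`, band `σ³ρ_r ≤ η₁`, temperature
floor `θ₁`, kinetic-energy-density cap `E₁` (whence `ρ_r ≤ 2E₁/(3θ₁)` and `|u_r|² ≤ 2E₁/ρ₁`).  On it the crux's
guard is inactive (`Hs = H_id + H_C`), `log h`, `1/θ_r`, `u_r` weights are bounded, and `f_ex` is read inside the
low-density band only. -/
def Regular (σ r τ η₁ ρ₁ θ₁ E₁ : ℝ)
    (Φ : HardSphereFlow (Torus.geometry (Fin 3)) (hsDiameter σ N) (N + 1)) (z : Config (N + 1) (Fin 3) T3) : Prop :=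
  ∀ s ∈ Set.Icc (0 : ℝ) τ, ∀ x : T3,
    ρ₁ ≤ rhoC r (Φ.flow s z) x ∧ σ ^ 3 * rhoC r (Φ.flow s z) x ≤ η₁ ∧
      θ₁ ≤ thetaC r (Φ.flow s z) x ∧ kinC r (Φ.flow s z) x ≤ E₁

/-- The NEW J-even mark family of the card's Transfer: `Ξ_S^k(n, v, w) = ((w − v)·n)₊ ((v + w)·n) n_k`
(quadratic in the velocities; J-even: `a₊` invariant, `(v+w)·n ↦ −`, `n_k ↦ −`).  With `c = w − u`,
`a(2c·n − a) = a((v+w)·n) − 2(u·n) a`, so the `∇θ`-channel of the offset is `Ξ_S` plus `Ξ_P` (13079's mark)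
contracted with `u`; Enskog target of `Ξ_S^k` at a Maxwellian pair: `ρ² · 2θ̃ · (4π/3) u_k`. -/
def sMark (k : Fin 3) (q : V3 × V3 × V3) : ℝ :=
  max ⟪q.2.2 - q.2.1, q.1⟫_ℝ 0 * (⟪q.2.2 + q.2.1, q.1⟫_ℝ * q.1 k)

/-! ## Two named statements used as ANTECEDENTS of other stubs (spelled out again verbatim inside the
registered texts of M and Θ, whose conclusions they are) -/

/-- ENTROPIC MAXWELLISATION on the regular set (conclusion of `stub_maxwellisation`; antecedent of K and O):
`∃ η₀ > 0` (band level up to which the mechanism works) such that, from continuous positive local-Gibbs profiles,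
for `σ < σ₀(profiles)`, any flows, any horizon `τ`, any floors with `η₁ ≤ η₀`:
`P({η < ∫₀^τ∫ KL(h(s,x,·) ‖ M[h](s,x,·)) dx ds} ∩ Regular) ≤ δ` for `r, ϑ < r₀(η,δ,…)`, `N ≥ N₀(r,ϑ)`. -/
def MaxwellisationStatement : Prop :=
  ∃ η₀ : ℝ, 0 < η₀ ∧ ∀ (a₀ θ₀ : T3 → ℝ) (u₀ : T3 → V3), Continuous a₀ → Continuous θ₀ → Continuous u₀ →
    (∀ x, 0 < a₀ x) → (∀ x, 0 < θ₀ x) → ∃ σ₀ : ℝ, 0 < σ₀ ∧ ∀ σ : ℝ, 0 < σ → σ < σ₀ →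
    ∀ Φ : (N : ℕ) → HardSphereFlow (Torus.geometry (Fin 3)) (hsDiameter σ N) (N + 1),
    ∀ τ : ℝ, 0 < τ → ∀ η₁ ρ₁ θ₁ E₁ : ℝ, 0 < η₁ → η₁ ≤ η₀ → 0 < ρ₁ → 0 < θ₁ → 0 < E₁ →
    ∀ η δ : ℝ, 0 < η → 0 < δ → ∃ r₀ : ℝ, 0 < r₀ ∧ ∀ r ϑ : ℝ, 0 < r → r < r₀ → 0 < ϑ → ϑ < r₀ →
    ∃ N₀ : ℕ, ∀ N : ℕ, N₀ ≤ N →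
      localGibbsLaw σ a₀ u₀ θ₀ N (Φ N)
          ({z | η < klFunctional σ r ϑ τ (Φ N) z} ∩ {z | Regular σ r τ η₁ ρ₁ θ₁ E₁ (Φ N) z})
        ≤ ENNReal.ofReal δ

/-- EVEN S-TRANSFER (conclusion of `stub_sTransfer`; antecedent of O): `EvenStressEnskog` for the marks `Ξ_S^k`,
crux-3 frame verbatim — `K_N[χ g(σ³ρ_r) Ξ_S^k] − σ³∫₀^τ∫ χ g Y(σ³ρ_r) B_r(Ξ_S^k) → 0` in probability. -/
def SStatement : Prop :=
  ∃ η₀ : ℝ, 0 < η₀ ∧ ∀ (a₀ θ₀ : T3 → ℝ) (u₀ : T3 → V3), Continuous a₀ → Continuous θ₀ → Continuous u₀ →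
    (∀ x, 0 < a₀ x) → (∀ x, 0 < θ₀ x) → ∃ σ₀ : ℝ, 0 < σ₀ ∧ ∀ σ : ℝ, 0 < σ → σ < σ₀ →
    ∀ Φ : (N : ℕ) → HardSphereFlow (Torus.geometry (Fin 3)) (hsDiameter σ N) (N + 1),
    ∀ τ : ℝ, 0 < τ → ∀ χ : ℝ × UnitAddTorus (Fin 3) → ℝ, Continuous χ → ∀ g : ℝ → ℝ, Continuous g →
    (∀ a, η₀ ≤ a → g a = 0) →
    ∀ η δ : ℝ, 0 < η → 0 < δ → ∃ r₀ : ℝ, 0 < r₀ ∧ ∀ r : ℝ, 0 < r → r < r₀ →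
    ∃ N₀ : ℕ, ∀ N : ℕ, N₀ ≤ N → ∀ k : Fin 3,
      localGibbsLaw σ a₀ u₀ θ₀ N (Φ N) {z | η < |evenStat σ N (Φ N) τ χ g (sMark k) r z|}
        ≤ ENNReal.ofReal δ

/-! ## The seven registered stubs (each: the statement `Prop` `Stubs.stub_*`, then the sorried theorem `stub_*`
with the same text; `*_iff` lemmas certify the two spellings agree by `Iff.rfl`) -/

/-- **R · REGULARITY FLOORS** (`stub_floors`).  Local-Gibbs frame, ALL `τ`: for every band level `η₁ > 0`,
continuous positive profiles, `σ < σ₀(η₁, profiles)`, any flows `Φ`, any `τ > 0`, there are floors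
`ρ₁, θ₁, E₁ > 0` (depending on everything so far) such that `∀ δ ∃ r₀ ∀ r < r₀ ∃ N₀ ∀ N ≥ N₀`:
`P(¬ Regular) ≤ δ` — w.h.p. NO vacuum pocket (`ρ_r ≥ ρ₁`), NO packing pocket (`σ³ρ_r ≤ η₁`), NO cold spot
(`θ_r ≥ θ₁`) and NO energy concentration (`e_r ≤ E₁`) of size `r` anywhere in `[0,τ] × 𝕋³`.  Why plausibly true:
`N → ∞` at fixed `r` puts `≍ N r³` particles in every ball; large deviations of the local Gibbs law at `s = 0`
(static, free), propagated: positions move by free flight (transport-Lipschitz clock of the sibling line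
`DensityCap/Lines/weak-lln-upgrade`, `stub_clock`), and the `s = 0` entropy bound relative to the invariant Gibbs
law forbids macroscopic packing/vacuum/cold pockets at later times in MEAN; the uniform-in-`(s,x)` upgrade is a
finite space–time grid + the clock.  Why it might fail / honest size: uniformly in `(s,x)` and for all `τ` this is
an a-priori NO-CONCENTRATION statement for deterministic spheres of the strength of `DensityCap` (13082, one-sided,
`t < T`) — open (L); its `τ < T` case is `DensityCap ∧ DiluteSelfConsistency` for the band plus the hydrodynamic
limit for the floors, which would be CIRCULAR inside `ParityInBand` (h₅ is consumed to prove the limit) — so R must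
come from a-priori bounds, not from the limit.  IMPLOSION HAZARD (the route's own, now at the particle level): for
focusing profiles whose limiting Euler flow develops a Guderley / Merle–Raphaël–Rodnianski–Szeftel-type density
spike, `σ³ρ_r ≤ η₁` fails at the focus as `r → 0` at fixed `σ` — exactly the `DenseExcursion → ¬DiluteSelfConsistency`
threat to 3091 (suspect-false) that already hangs over `closes`; if it materialises, the crux needs the packing guard
of `HydroLimitInBand` (a CRUX-LEVEL repair for tenure) and this line survives verbatim under the guard (R then reads
"floors + cap below the guard").  Weaker forms suffice for K/O (floors in `L¹(supp φ)`-probability);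
the uniform event is chosen to keep every other stub guard-free.  Leans on: tree `localGibbsLaw`,
`localGibbs_lln_holds` / `localGibbs_densityLLN_holds`, `HardSphereFlow.configEnergy_flow`, `integral_cone_eq_one`,
`rhoC_le_const`, `cone_le`, sibling `stub_clock`; OllaVaradhanYau1993 §3 (entropy w.r.t. the invariant law),
Spohn1991 II.3. -/
def Stubs.stub_floors : Prop :=
    ∀ η₁ : ℝ, 0 < η₁ → ∀ (a₀ θ₀ : T3 → ℝ) (u₀ : T3 → V3), Continuous a₀ → Continuous θ₀ → Continuous u₀ →
      (∀ x, 0 < a₀ x) → (∀ x, 0 < θ₀ x) → ∃ σ₀ : ℝ, 0 < σ₀ ∧ ∀ σ : ℝ, 0 < σ → σ < σ₀ →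
      ∀ Φ : (N : ℕ) → HardSphereFlow (Torus.geometry (Fin 3)) (hsDiameter σ N) (N + 1),
      ∀ τ : ℝ, 0 < τ → ∃ ρ₁ θ₁ E₁ : ℝ, 0 < ρ₁ ∧ 0 < θ₁ ∧ 0 < E₁ ∧
      ∀ δ : ℝ, 0 < δ → ∃ r₀ : ℝ, 0 < r₀ ∧ ∀ r : ℝ, 0 < r → r < r₀ → ∃ N₀ : ℕ, ∀ N : ℕ, N₀ ≤ N →
        localGibbsLaw σ a₀ u₀ θ₀ N (Φ N) {z | ¬ Regular σ r τ η₁ ρ₁ θ₁ E₁ (Φ N) z} ≤ ENNReal.ofReal δ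

/-- Registered stub R (`Stubs.stub_floors`, verbatim): the `sorry` to be discharged. -/
theorem stub_floors :
    ∀ η₁ : ℝ, 0 < η₁ → ∀ (a₀ θ₀ : T3 → ℝ) (u₀ : T3 → V3), Continuous a₀ → Continuous θ₀ → Continuous u₀ →
      (∀ x, 0 < a₀ x) → (∀ x, 0 < θ₀ x) → ∃ σ₀ : ℝ, 0 < σ₀ ∧ ∀ σ : ℝ, 0 < σ → σ < σ₀ →
      ∀ Φ : (N : ℕ) → HardSphereFlow (Torus.geometry (Fin 3)) (hsDiameter σ N) (N + 1),
      ∀ τ : ℝ, 0 < τ → ∃ ρ₁ θ₁ E₁ : ℝ, 0 < ρ₁ ∧ 0 < θ₁ ∧ 0 < E₁ ∧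
      ∀ δ : ℝ, 0 < δ → ∃ r₀ : ℝ, 0 < r₀ ∧ ∀ r : ℝ, 0 < r → r < r₀ → ∃ N₀ : ℕ, ∀ N : ℕ, N₀ ≤ N →
        localGibbsLaw σ a₀ u₀ θ₀ N (Φ N) {z | ¬ Regular σ r τ η₁ ρ₁ θ₁ E₁ (Φ N) z} ≤ ENNReal.ofReal δ := by
  sorry

theorem stub_floors_iff : Stubs.stub_floors ↔
    ∀ η₁ : ℝ, 0 < η₁ → ∀ (a₀ θ₀ : T3 → ℝ) (u₀ : T3 → V3), Continuous a₀ → Continuous θ₀ → Continuous u₀ →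
      (∀ x, 0 < a₀ x) → (∀ x, 0 < θ₀ x) → ∃ σ₀ : ℝ, 0 < σ₀ ∧ ∀ σ : ℝ, 0 < σ → σ < σ₀ →
      ∀ Φ : (N : ℕ) → HardSphereFlow (Torus.geometry (Fin 3)) (hsDiameter σ N) (N + 1),
      ∀ τ : ℝ, 0 < τ → ∃ ρ₁ θ₁ E₁ : ℝ, 0 < ρ₁ ∧ 0 < θ₁ ∧ 0 < E₁ ∧
      ∀ δ : ℝ, 0 < δ → ∃ r₀ : ℝ, 0 < r₀ ∧ ∀ r : ℝ, 0 < r → r < r₀ → ∃ N₀ : ℕ, ∀ N : ℕ, N₀ ≤ N →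
        localGibbsLaw σ a₀ u₀ θ₀ N (Φ N) {z | ¬ Regular σ r τ η₁ ρ₁ θ₁ E₁ (Φ N) z} ≤ ENNReal.ofReal δ :=
  Iff.rfl

/-- **M · ENTROPIC MAXWELLISATION FROM THE ROUTE'S KINETIC CRUXES** (`stub_maxwellisation`):
`OddContactSymmetry → RateFloor → CollisionTightness → EmpiricalEnskogIdentity → MaxwellisationStatement`.
Content (card `production-currency` (ii-a), endorsed by all three triagers as CORRECT at fixed `r`): by the exact
microscopic Enskog identity (13086, free COLLISIONAL BALANCE: `K_N[χ g F] → 0` at fixed `r` — every exact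
collisional difference carries a factor `ε`) and `OddContactSymmetry` at `Ψ → F` (13078, via its countable dense
family of bounded odd marks + truncation, `CollisionTightness` 13085 making `K_N` tight), the EVEN statistic
`¼K_N[χ g F(1 − e^{−F})] = ¼K_N[χ g F] − ¼K_N[χ g F(1 + e^{−F})] → 0` in probability (Euler precision; the
`O(r⁴)`/`O(r)` mixture terms of the triage's rock (M) sit inside `∃ r₀(η)`); `RateFloor` (13080) applied to the
non-negative mark `F(1 − e^{−F})` (truncated) bounds the time-integrated Boltzmann entropy production of `h_r`
against the ideal contact law, `∫₀^τ∫ D_B(h(s,x,·)) dx ds`, by `g₀⁻¹σ⁻³ ×` that statistic; the Cercignani-type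
coercivity `D_B(h) ≥ c(ρ_r,θ̃_r,moments, Gaussian lower bound) · KL(h ‖ M[h])^{1+ε}` (Villani 2003; the Gaussian
lower bound of `h = G_ϑ ∗ μ` degrades with the local maximal speed `≍ √log N` and must enter logarithmically —
triage r1-2 sharpen (b)) on `Regular` converts it into `klFunctional → 0`.  Band: `η₁ ≤ η₀ := min` of the
thresholds of 13078/13080 (their cutoff `g` is taken `≡ 1` on `[0,η₁]`, `≡ 0` above `η₀`; on `Regular` it is
inert).  Why it might fail / honest size: the unbounded surprisal marks need the truncation + second-moment
uniform integrability along the true flow (the all-`τ` local-Gibbs sibling of `KineticEnergyTails` 13087, which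
is typed only for `t < T`), and the coercivity constants must be uniform on `Regular` — XL (open through its
antecedents; L given them).  Not hit by the fixed-`r` rock: a `K_N`-level (Euler-normalised) statement.  Leans on:
tree `entropyProduction`, `entropyProduction_nonneg`, `hardSphereKernel`, `eGain_le_mul_eLoss_add_eDissipation`,
`oddStat`/`oddStatTrunc` (CollisionTubeFunctional), Mathlib `InformationTheory.klDiv`; route items 13078, 13080,
13085, 13086 BY NAME; sibling ideas `production-currency` (ii-a), `termwise-even-channel-mesoscale` S2;
Villani2003 (Cercignani's conjecture), ToscaniVillani1999, CIP1994 §3, Resibois1978. -/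
def Stubs.stub_maxwellisation : Prop :=
    OddContactSymmetry → RateFloor → CollisionTightness → EmpiricalEnskogIdentity →
    ∃ η₀ : ℝ, 0 < η₀ ∧ ∀ (a₀ θ₀ : T3 → ℝ) (u₀ : T3 → V3), Continuous a₀ → Continuous θ₀ → Continuous u₀ →
      (∀ x, 0 < a₀ x) → (∀ x, 0 < θ₀ x) → ∃ σ₀ : ℝ, 0 < σ₀ ∧ ∀ σ : ℝ, 0 < σ → σ < σ₀ →
      ∀ Φ : (N : ℕ) → HardSphereFlow (Torus.geometry (Fin 3)) (hsDiameter σ N) (N + 1),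
      ∀ τ : ℝ, 0 < τ → ∀ η₁ ρ₁ θ₁ E₁ : ℝ, 0 < η₁ → η₁ ≤ η₀ → 0 < ρ₁ → 0 < θ₁ → 0 < E₁ →
      ∀ η δ : ℝ, 0 < η → 0 < δ → ∃ r₀ : ℝ, 0 < r₀ ∧ ∀ r ϑ : ℝ, 0 < r → r < r₀ → 0 < ϑ → ϑ < r₀ →
      ∃ N₀ : ℕ, ∀ N : ℕ, N₀ ≤ N →
        localGibbsLaw σ a₀ u₀ θ₀ N (Φ N)
            ({z | η < klFunctional σ r ϑ τ (Φ N) z} ∩ {z | Regular σ r τ η₁ ρ₁ θ₁ E₁ (Φ N) z})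
          ≤ ENNReal.ofReal δ

/-- Registered stub M (`Stubs.stub_maxwellisation`, verbatim): the `sorry` to be discharged. -/
theorem stub_maxwellisation :
    OddContactSymmetry → RateFloor → CollisionTightness → EmpiricalEnskogIdentity →
    ∃ η₀ : ℝ, 0 < η₀ ∧ ∀ (a₀ θ₀ : T3 → ℝ) (u₀ : T3 → V3), Continuous a₀ → Continuous θ₀ → Continuous u₀ →
      (∀ x, 0 < a₀ x) → (∀ x, 0 < θ₀ x) → ∃ σ₀ : ℝ, 0 < σ₀ ∧ ∀ σ : ℝ, 0 < σ → σ < σ₀ →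
      ∀ Φ : (N : ℕ) → HardSphereFlow (Torus.geometry (Fin 3)) (hsDiameter σ N) (N + 1),
      ∀ τ : ℝ, 0 < τ → ∀ η₁ ρ₁ θ₁ E₁ : ℝ, 0 < η₁ → η₁ ≤ η₀ → 0 < ρ₁ → 0 < θ₁ → 0 < E₁ →
      ∀ η δ : ℝ, 0 < η → 0 < δ → ∃ r₀ : ℝ, 0 < r₀ ∧ ∀ r ϑ : ℝ, 0 < r → r < r₀ → 0 < ϑ → ϑ < r₀ →
      ∃ N₀ : ℕ, ∀ N : ℕ, N₀ ≤ N →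
        localGibbsLaw σ a₀ u₀ θ₀ N (Φ N)
            ({z | η < klFunctional σ r ϑ τ (Φ N) z} ∩ {z | Regular σ r τ η₁ ρ₁ θ₁ E₁ (Φ N) z})
          ≤ ENNReal.ofReal δ := by
  sorry

theorem stub_maxwellisation_iff : Stubs.stub_maxwellisation ↔
    (OddContactSymmetry → RateFloor → CollisionTightness → EmpiricalEnskogIdentity → MaxwellisationStatement) :=
  Iff.rfl

/-- **K · KINETIC ENTROPY BALANCE in the crux's convective weak form** (`stub_kineticBalance`):
`CollisionTightness → MaxwellisationStatement → ∃ η₀ …` (13085 by name: `K_N`-tightness of the collision count,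
which every error term below is measured against): from local-Gibbs profiles, for `σ < σ₀`, any flows, `τ`, smooth `φ ≥ 0`
supported before `τ`, floors with band level `η₁ ≤ η₀`:  `P({kinF + initKin − P2 < −η} ∩ Regular) ≤ δ` for
`r, ϑ < r₀`, `N ≥ N₀` — the ideal-gas part of the crux functional plus the empirical kinetic boundary term is
bounded BELOW by the two-point production functional.  Content (exact pieces first): (a) PATHWISE EXACT BALANCE on
`Φ.good`: between collisions `∂ₛh + v·∇ₓh = −ϑ²∇ₓ·∇ᵥh` (cone translation-invariance, Gaussian kernel), so
`∂ₛh_kin + ∇ₓ·J_K = ϑ²∫(∇ᵥh·∇ₓh)/h dv` with `J_K = ∫ v h log h dv`; at a collision the jump of `∫∫φ h log h` is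
`≤ −(N+1)⁻¹ jump2` (convexity of `a log a` at the FINAL law, card `termwise-surprisal-positivity` `JumpDomination`),
and `φ(τ′..) = 0` kills the final-time term (`_false_without_support`); hence
`∫∫(h_kin∂ₛφ + J_K·∇φ) + ∫h_kin(0)φ(0) ≥ P2 − ϑ²∫∫φR`; (b) EXACT CONTINUITY of the cone density
(`∂ₛρ_r + div m_r = 0` weakly, positions continuous) makes the `c₀ρ_r` terms cancel; (c) on `Regular ∩ good`,
`Hs = H_id + H_C` and both halves are integrable, so `kinF = ∫∫H_id(ρ_r,θ_r)(∂ₛφ + u_r·∇φ)`; (d) ENTROPY-VALUE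
MAXWELLISATION: `H_id(ρ_r,θ_r) − (h_kin + c₀ρ_r) = (3/2)ρ_r log(1 + ϑ²/θ_r) − KL(h‖M[h])`, the first
`≤ (3/2)ρ_r ϑ²/θ₁` on `Regular` (cold spots, S7 `ColdSpotsNegligible` — free on `Regular`), the second small in
`L¹` by the antecedent, against the weight `|∂ₛφ| + |u_r||∇φ| ≤ C_φ(1 + √(2E₁/ρ₁))` on `Regular`; (e) the
streaming commutator `ϑ²∫∫φR = O(ϑ²)` in probability; (f) the FLUX REPLACEMENT `∫∫∇φ·(h_kin u_r − J_K) =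
−∫∫∇φ·∫(v − u_r) h log h dv → 0`: the CONDUCTIVE kinetic entropy flux (`≈ q/θ`), zero at a Maxwellian, a
`|v|³`-weighted closeness of `h` to `M[h]` — the weak CUBIC heat-flux closure (N1) that card
`exact-entropy-ledger-three-passivities` proved NECESSARY for the crux as typed (its `c/V³` streaming witness) and
that the route header's "quadratic, not cubic" overlooks: it lives HERE and nowhere else in this line.  Why it
might fail / honest size: (f) needs either collision-weighted uniform integrability of `|v|³` along the true flow
or the mesoscale rate argument of card `termwise-even-channel-mesoscale` (KL at rate × 6th moment); (a)–(e) are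
provable now but heavy (weak time-derivatives of piecewise-smooth functionals along `IsHardSphereTrajectory`,
a.e. calculus for Lipschitz cone fields) — XL overall.  Frame hygiene: keeps `∃ r₀ ∀ r ϑ ∃ N₀` (never `r` after
`N`, `not_localSecondLawRAfterN`); tight at equilibrium (`P2 → 0`, `kinF + initKin → 0`).  Leans on: tree
`entropyFunctional`, `Hs`, `Hs_ge`, `integral_kinC_le`, `integral_cone_eq_one`, `IsHardSphereTrajectory.{free,
locFinite, pos_continuous}`, `sub_eq_integral_add_finsum_collisionJump_td`, `HardSphereFlow.measurable_flow_prod_torus`,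
`localGibbsLaw_compl_good`-type null sets, Mathlib convexity of `x log x` (`Real.convexOn_mul_log`); cards
`kinetic-supersolution-kn-budget` (S1, (3), S3–S5), `termwise-surprisal-positivity` (S1, `JumpDomination`, S7);
CIP1994 §3.2, Resibois1978, Spohn1991 II.3, GarridoGoldsteinLebowitz2004 (arXiv:cond-mat/0310575). -/
def Stubs.stub_kineticBalance : Prop :=
    CollisionTightness → MaxwellisationStatement →
    ∃ η₀ : ℝ, 0 < η₀ ∧ ∀ (a₀ θ₀ : T3 → ℝ) (u₀ : T3 → V3), Continuous a₀ → Continuous θ₀ → Continuous u₀ →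
      (∀ x, 0 < a₀ x) → (∀ x, 0 < θ₀ x) → ∃ σ₀ : ℝ, 0 < σ₀ ∧ ∀ σ : ℝ, 0 < σ → σ < σ₀ →
      ∀ Φ : (N : ℕ) → HardSphereFlow (Torus.geometry (Fin 3)) (hsDiameter σ N) (N + 1),
      ∀ τ : ℝ, 0 < τ → ∀ φ : ℝ → T3 → ℝ, Literature.Analysis.FunctionSpaces.Torus.IsSmoothSpaceTimeOn Set.univ φ →
      (∀ s x, 0 ≤ φ s x) → (∃ τ' : ℝ, τ' < τ ∧ ∀ s, τ' ≤ s → ∀ x, φ s x = 0) →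
      ∀ η₁ ρ₁ θ₁ E₁ : ℝ, 0 < η₁ → η₁ ≤ η₀ → 0 < ρ₁ → 0 < θ₁ → 0 < E₁ →
      ∀ η δ : ℝ, 0 < η → 0 < δ → ∃ r₀ : ℝ, 0 < r₀ ∧ ∀ r ϑ : ℝ, 0 < r → r < r₀ → 0 < ϑ → ϑ < r₀ →
      ∃ N₀ : ℕ, ∀ N : ℕ, N₀ ≤ N →
        localGibbsLaw σ a₀ u₀ θ₀ N (Φ N)
            ({z | kinFunctional σ r τ φ (Φ N) z + initKin σ r ϑ φ (Φ N) z - P2 σ N (Φ N) τ r ϑ φ z < -η} ∩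
              {z | Regular σ r τ η₁ ρ₁ θ₁ E₁ (Φ N) z})
          ≤ ENNReal.ofReal δ

/-- Registered stub K (`Stubs.stub_kineticBalance`, verbatim): the `sorry` to be discharged. -/
theorem stub_kineticBalance :
    CollisionTightness → MaxwellisationStatement →
    ∃ η₀ : ℝ, 0 < η₀ ∧ ∀ (a₀ θ₀ : T3 → ℝ) (u₀ : T3 → V3), Continuous a₀ → Continuous θ₀ → Continuous u₀ →
      (∀ x, 0 < a₀ x) → (∀ x, 0 < θ₀ x) → ∃ σ₀ : ℝ, 0 < σ₀ ∧ ∀ σ : ℝ, 0 < σ → σ < σ₀ →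
      ∀ Φ : (N : ℕ) → HardSphereFlow (Torus.geometry (Fin 3)) (hsDiameter σ N) (N + 1),
      ∀ τ : ℝ, 0 < τ → ∀ φ : ℝ → T3 → ℝ, Literature.Analysis.FunctionSpaces.Torus.IsSmoothSpaceTimeOn Set.univ φ →
      (∀ s x, 0 ≤ φ s x) → (∃ τ' : ℝ, τ' < τ ∧ ∀ s, τ' ≤ s → ∀ x, φ s x = 0) →
      ∀ η₁ ρ₁ θ₁ E₁ : ℝ, 0 < η₁ → η₁ ≤ η₀ → 0 < ρ₁ → 0 < θ₁ → 0 < E₁ →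
      ∀ η δ : ℝ, 0 < η → 0 < δ → ∃ r₀ : ℝ, 0 < r₀ ∧ ∀ r ϑ : ℝ, 0 < r → r < r₀ → 0 < ϑ → ϑ < r₀ →
      ∃ N₀ : ℕ, ∀ N : ℕ, N₀ ≤ N →
        localGibbsLaw σ a₀ u₀ θ₀ N (Φ N)
            ({z | kinFunctional σ r τ φ (Φ N) z + initKin σ r ϑ φ (Φ N) z - P2 σ N (Φ N) τ r ϑ φ z < -η} ∩
              {z | Regular σ r τ η₁ ρ₁ θ₁ E₁ (Φ N) z})
          ≤ ENNReal.ofReal δ := by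
  sorry

/-- **S · LOCAL NET PRODUCTION** (`stub_netProduction`; THE KINETIC BET, shared verbatim in content with card
`kinetic-supersolution-kn-budget`'s `LocalNetProduction`, here in the SMEARED one-point form).
`CollisionTightness →` (13085 by name), local-Gibbs frame,
all `τ`, smooth `φ ≥ 0`, any floors: `P({P1 < −η} ∩ Regular) ≤ δ` for `r, ϑ < r₀`, `N ≥ N₀`: the per-unit-time,
`φ`-weighted sum of the ONE-POINT surprisal jumps (both partners read around `xᵢ`, reference = the mollified
empirical law itself) is not macroscopically NEGATIVE.  Why plausibly true: it is a NET (unsplit) statistic, so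
the fixed-`r` mixture rock does not touch it — for ANY reference `b`, `E_p[F_b] = 0` under every J-invariant
contact law (triage r1-3 §1 (a)); pre-shock the genuine net production is `O(Kn) → 0` and the `O(r²)` mollification
residue is absorbed by `r₀(η)`; through a steady shock of Mach `1.2–8` the one-point statistic equals
`S(½) ∈ [0.91, 1.36] × P_true > 0` (triage r1-1 (S), `toy/shock_reference_quad.py`; kit `j011545`).  Why it might
fail: post-`T` there is NO mechanism on the panel — a shock-layer velocity law whose one-point net jump against the
50/50 cone mixture is negative would kill it (the exact balance only signs the `x₀`-smeared TWO-point jump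
`∫₀¹S(α)dα = P_true`); a J-odd contact correlation at `O(Kn)` with the wrong sign orthogonal to the balance
directions (the route's own hazard for 13078) pre-shock is invisible here (absorbed) — so S is strictly a
post-shock / large-deviation bet.  Size L (open).  Tight at equilibrium.  Leans on: this file's `P1`, `jump1`,
`sDrop`; tree `oddStat` (the `K_N` chassis), `measurePreserving_swap_negDir`, `entropyProduction_nonneg`; cards
`kinetic-supersolution-kn-budget` (first lemma), `termwise-surprisal-positivity` (`SurprisalSignCore`); CIP1994
§3.2, Villani2002 Ch. 2, Resibois1978. -/
def Stubs.stub_netProduction : Prop :=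
    CollisionTightness →
    ∀ (a₀ θ₀ : T3 → ℝ) (u₀ : T3 → V3), Continuous a₀ → Continuous θ₀ → Continuous u₀ →
      (∀ x, 0 < a₀ x) → (∀ x, 0 < θ₀ x) → ∃ σ₀ : ℝ, 0 < σ₀ ∧ ∀ σ : ℝ, 0 < σ → σ < σ₀ →
      ∀ Φ : (N : ℕ) → HardSphereFlow (Torus.geometry (Fin 3)) (hsDiameter σ N) (N + 1),
      ∀ τ : ℝ, 0 < τ → ∀ φ : ℝ → T3 → ℝ, Literature.Analysis.FunctionSpaces.Torus.IsSmoothSpaceTimeOn Set.univ φ →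
      (∀ s x, 0 ≤ φ s x) →
      ∀ η₁ ρ₁ θ₁ E₁ : ℝ, 0 < η₁ → 0 < ρ₁ → 0 < θ₁ → 0 < E₁ →
      ∀ η δ : ℝ, 0 < η → 0 < δ → ∃ r₀ : ℝ, 0 < r₀ ∧ ∀ r ϑ : ℝ, 0 < r → r < r₀ → 0 < ϑ → ϑ < r₀ →
      ∃ N₀ : ℕ, ∀ N : ℕ, N₀ ≤ N →
        localGibbsLaw σ a₀ u₀ θ₀ N (Φ N)
            ({z | P1 σ N (Φ N) τ r ϑ φ z < -η} ∩ {z | Regular σ r τ η₁ ρ₁ θ₁ E₁ (Φ N) z})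
          ≤ ENNReal.ofReal δ

/-- Registered stub S (`Stubs.stub_netProduction`, verbatim): the `sorry` to be discharged. -/
theorem stub_netProduction :
    CollisionTightness →
    ∀ (a₀ θ₀ : T3 → ℝ) (u₀ : T3 → V3), Continuous a₀ → Continuous θ₀ → Continuous u₀ →
      (∀ x, 0 < a₀ x) → (∀ x, 0 < θ₀ x) → ∃ σ₀ : ℝ, 0 < σ₀ ∧ ∀ σ : ℝ, 0 < σ → σ < σ₀ →
      ∀ Φ : (N : ℕ) → HardSphereFlow (Torus.geometry (Fin 3)) (hsDiameter σ N) (N + 1),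
      ∀ τ : ℝ, 0 < τ → ∀ φ : ℝ → T3 → ℝ, Literature.Analysis.FunctionSpaces.Torus.IsSmoothSpaceTimeOn Set.univ φ →
      (∀ s x, 0 ≤ φ s x) →
      ∀ η₁ ρ₁ θ₁ E₁ : ℝ, 0 < η₁ → 0 < ρ₁ → 0 < θ₁ → 0 < E₁ →
      ∀ η δ : ℝ, 0 < η → 0 < δ → ∃ r₀ : ℝ, 0 < r₀ ∧ ∀ r ϑ : ℝ, 0 < r → r < r₀ → 0 < ϑ → ϑ < r₀ →
      ∃ N₀ : ℕ, ∀ N : ℕ, N₀ ≤ N →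
        localGibbsLaw σ a₀ u₀ θ₀ N (Φ N)
            ({z | P1 σ N (Φ N) τ r ϑ φ z < -η} ∩ {z | Regular σ r τ η₁ ρ₁ θ₁ E₁ (Φ N) z})
          ≤ ENNReal.ofReal δ := by
  sorry

/-- **Θ · EVEN S-TRANSFER** (`stub_sTransfer`; the card's Transfer `C⁺ = EvenStressEnskog ∧ EvenThetaTransfer`
minus what is already filed).  Exactly the frame of `EvenStressEnskog` (13079; `evenStat` of
`EvenCollisionTubeFunctional.lean`, `evenStressEnskog_iff` in the sibling line) with the momentum-transfer marks
`Ξ_P^{kl}` replaced by `Ξ_S^k = ((w−v)·n̂)₊((v+w)·n̂) n̂_k` (`sMark k`): `K_N[χ g(σ³ρ_r) Ξ_S^k] − σ³∫₀^τ∫ χ g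
Y(σ³ρ_r) B_r(Ξ_S^k) dx ds → 0` in probability (`N → ∞` at fixed `r`, then `r → 0`), fixed continuous weight `χ`,
continuous cutoff `g` vanishing above `η₀`.  Why the card needs it: the `∇θ̃`-channel of the offset carries the
mark `a(2c_w·n̂ − a)n̂_k = Ξ_S^k − 2 Σ_m u_m Ξ_P^{mk}` (`c_w = w − u_r`): the `u`-dependent half is 13079's mark
contracted with `φ u_r ∂_kθ̃_r/θ̃_r²`, the Galilean-covariant remainder is `Ξ_S`; the Enskog targets are the
EMPIRICAL pair functionals `B_r` (no Maxwellian assumption), whose Maxwellian values `2θ̃(4π/3)ρ²u_k` and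
`−2u_m·θ̃(4π/3)ρ²δ_{mk}` cancel — the Gaussian identity (β) `E[a₊ a (c_v + c_w)·n̂] = 0` (sum ⟂ difference of
i.i.d. Gaussians; holds for any law symmetric under `c ↦ −c`).  Why it might fail / honest size: crux-3 class —
J-even velocity-dependent contact structure at positive times (|g|-dependent approach rates, shear-induced contact
anisotropy at finite `Kn`, Lutsko1996/2001) would shift the contact value off `Y`; QUADRATIC in the velocities
(13079's `Ξ_P` is linear), so its velocity truncation needs the collision-weighted second-moment tail — still
"quadratic, not cubic" (`KineticEnergyTails`-level).  Provable by TRANSPLANT of the sibling skeleton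
`Cruxes/EvenStressEnskog/Lines/even-rung-mean-variance.lean` (truncate · cylinder pull-back · mean = Enskog ·
fixed-time variance · L²→probability · regularity) with `evenMark k l ↦ sMark k`; size XL (open), L at rung 0.
Leans on: tree `evenStat`, `collisionSum`, `enskogRate`, `pairFunctional`, `contactValue`, `sphereMark`,
`tubeStat`; route item 13079 (pattern, and its proof chassis), `HsEosLowDensity` (regularity of `Y` on the band);
ChapmanCowling1970 §16.4, VanbeijerenErnst1973, Resibois1978, Lutsko1996, Lutsko2001. -/
def Stubs.stub_sTransfer : Prop :=
    ∃ η₀ : ℝ, 0 < η₀ ∧ ∀ (a₀ θ₀ : T3 → ℝ) (u₀ : T3 → V3), Continuous a₀ → Continuous θ₀ → Continuous u₀ →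
      (∀ x, 0 < a₀ x) → (∀ x, 0 < θ₀ x) → ∃ σ₀ : ℝ, 0 < σ₀ ∧ ∀ σ : ℝ, 0 < σ → σ < σ₀ →
      ∀ Φ : (N : ℕ) → HardSphereFlow (Torus.geometry (Fin 3)) (hsDiameter σ N) (N + 1),
      ∀ τ : ℝ, 0 < τ → ∀ χ : ℝ × UnitAddTorus (Fin 3) → ℝ, Continuous χ → ∀ g : ℝ → ℝ, Continuous g →
      (∀ a, η₀ ≤ a → g a = 0) →
      ∀ η δ : ℝ, 0 < η → 0 < δ → ∃ r₀ : ℝ, 0 < r₀ ∧ ∀ r : ℝ, 0 < r → r < r₀ →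
      ∃ N₀ : ℕ, ∀ N : ℕ, N₀ ≤ N → ∀ k : Fin 3,
        localGibbsLaw σ a₀ u₀ θ₀ N (Φ N) {z | η < |evenStat σ N (Φ N) τ χ g (sMark k) r z|}
          ≤ ENNReal.ofReal δ

/-- Registered stub Θ (`Stubs.stub_sTransfer`, verbatim): the `sorry` to be discharged. -/
theorem stub_sTransfer :
    ∃ η₀ : ℝ, 0 < η₀ ∧ ∀ (a₀ θ₀ : T3 → ℝ) (u₀ : T3 → V3), Continuous a₀ → Continuous θ₀ → Continuous u₀ →
      (∀ x, 0 < a₀ x) → (∀ x, 0 < θ₀ x) → ∃ σ₀ : ℝ, 0 < σ₀ ∧ ∀ σ : ℝ, 0 < σ → σ < σ₀ →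
      ∀ Φ : (N : ℕ) → HardSphereFlow (Torus.geometry (Fin 3)) (hsDiameter σ N) (N + 1),
      ∀ τ : ℝ, 0 < τ → ∀ χ : ℝ × UnitAddTorus (Fin 3) → ℝ, Continuous χ → ∀ g : ℝ → ℝ, Continuous g →
      (∀ a, η₀ ≤ a → g a = 0) →
      ∀ η δ : ℝ, 0 < η → 0 < δ → ∃ r₀ : ℝ, 0 < r₀ ∧ ∀ r : ℝ, 0 < r → r < r₀ →
      ∃ N₀ : ℕ, ∀ N : ℕ, N₀ ≤ N → ∀ k : Fin 3,
        localGibbsLaw σ a₀ u₀ θ₀ N (Φ N) {z | η < |evenStat σ N (Φ N) τ χ g (sMark k) r z|}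
          ≤ ENNReal.ofReal δ := by
  sorry

theorem stub_sTransfer_iff : Stubs.stub_sTransfer ↔ SStatement := Iff.rfl

/-- **O · OFFSET IS CONFIGURATIONAL** (`stub_offset`; THIS CARD'S LEVER, the card's `OffsetIsConfigurational`
in the triage's conditional form "`EvenStressEnskog ∧ EvenThetaTransfer ∧ Maxwellisation ⇒ …`", inside the band):
`EvenStressEnskog → CollisionTightness → HsEosLowDensity → SStatement → MaxwellisationStatement → ∃ η₀ …`
(13079, 13085, 0768 by name): local-Gibbs frame, all `τ`, smooth `φ` supported before `τ` (sign of `φ`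
irrelevant), floors with `η₁ ≤ η₀`:
`P({η < |(P2 − P1) + confF + initConf|} ∩ Regular) ≤ δ` for `r, ϑ < r₀`, `N ≥ N₀` — Résibois' consistency
identity read on the empirical contact statistics: the per-unit-time ENSKOG OFFSET of the surprisal-jump sum
(`jump2 − jump1`: partner `j`'s smeared drop read around `x_j = x_i − εn̂` minus around `x_i`, `O(ε)` per
collision, `× Kn⁻¹` collisions) cancels the weak material derivative of `H_C(ρ_r) = ρ_r f_ex(σ³ρ_r)` with its
initial term.  Layer-2 content (all named in the line card; the first three provable now): (T) FINITE-DIFFERENCE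
step in the cone CENTRE (smooth: `y ↦ sDrop … y …` is a cone average) — `jump2 − jump1 = −ε n̂·∇_y sDrop + O(ε²/r²)`;
(G) at a local Maxwellian `M_{ρ,u,θ̃}` the drop of partner `j` is `Λ(y) = −a(2c·n̂ − a)/(2θ̃(y))`, `c = w − u(y)`,
`a = (w−v)·n̂`, so `−n̂·∇Λ = −(a/θ̃)(n̂·∇u·n̂) − a(2c·n̂ − a)(n̂·∇θ̃)/(2θ̃²)` (card's Taylor formula, re-derived
×3), i.e. marks `Ξ_P^{kl}` ⊗ weights `φ∂_lu_k/θ̃`, `Ξ_P^{mk}` ⊗ `φ u_m∂_kθ̃/θ̃²`, `Ξ_S^k` ⊗ `φ∂_kθ̃/(2θ̃²)`, with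
`(u, θ̃) = (u_r, θ_r + ϑ²)` the cone fields (a.e.-differentiable, `r⁻⁴`-Lipschitz on `Regular`; the self-term apex
kink is `O(1/(N r⁴))`) — the replacement `h ↦ M[h]` inside the `hm⊗hm`-weighted log-differences is where the
antecedent `MaxwellisationStatement` and the floors enter (integrate the difference quotient by parts onto the
smooth weights first); (N) NET STEP: the antecedents quantify FIXED continuous `χ`; approximate the
configuration-dependent weights by a finite `η`-net of continuous functions using their `Regular`-equicontinuity in
`x` (`r⁻⁴`-Lipschitz) and in `s` (free-flight clock + `O(εν) = O(σ³)` collisional drift), union bound (triage r1-2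
sharpen (d)); (E) ENSKOG VALUES from the antecedents: `EvenStressEnskog` for `Ξ_P` and `SStatement` for `Ξ_S`
give `K_N[χ g Ξ] → σ³∫∫χ g Y B_r(Ξ)` (cutoff `g ≡ 1` on `[0,η₁]`, inert on `Regular`); (A) GAUSSIAN EVALUATION of
the empirical pair functionals at the Maxwellised law: (α) `E[a₊²] = θ̃`, `∫n̂_kn̂_l = (4π/3)δ_kl` ⇒
`B_r(Ξ_P^{kl}) → ρ_r²θ̃(4π/3)δ_kl`, so the `∇u`-channel is `−(2π/3)σ³∫∫φ Y ρ_r² div u_r` (shear drops out), and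
(β) the `∇θ̃`-channel VANISHES; (W) WORK IDENTITY (card `exact-entropy-ledger`'s `ConfigurationalWorkIdentity`, exact,
pathwise on `Regular ∩ good`): `confF + initConf = −∫∫φ(∂ₛH_C(ρ_r) + div(H_C(ρ_r)u_r)) = +σ³∫∫φ ρ_r² f_ex′(σ³ρ_r)
div u_r` by the renormalised EXACT continuity equation of the cone density (`G − ρG′ = −σ³ρ²f′` for
`G = ρf(σ³ρ)`); (Y) thermodynamic consistency closes it: `−(2π/3)Y + f_ex′ = 0` iff `Y = (3/2π)f_ex′` — the tree's
`contactValue`, regular on the band by `HsEosLowDensity` (`deriv`-junk outside: triage r1-1 sharpen; hence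
`η₁ ≤ η₀ ≤` the analytic band).  Errors: `O(ε/r)` (second-order finite difference), `O(r²)` (cone mixture inside
`hm`, triage r1-2 caveat), `O((N r³ϑ³)^{−1/2})` (sampling noise), all inside `∃ r₀ ∀ r ϑ ∃ N₀`.  Why it might
fail: only through its antecedents' frame — the net step needs the weights' modulus of continuity UNIFORM on
`Regular` w.h.p. (true at fixed `r`), and across a shock layer (volume fraction `O(r)` of an `O(1)` statistic) the
Maxwellian evaluation fails on a set that must stay `O(r)` (no `1/r` concentration of collisions: implied by the
cap `E₁` + band).  Size L given the antecedents.  Tight at equilibrium (`div u_r → 0`: both sides vanish).  Leans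
on: this file's vocabulary; tree `evenStat`, `evenMark`, `contactValue`, `pairFunctional`, `hsExcessFreeEnergy`,
`integral_inner_gradient_eq_neg_integral_mul_divergence_holds` (torus IBP), `Torus.partialDeriv`,
`integral_cone_eq_one`, Mathlib Gaussian moments (`ProbabilityTheory.gaussianReal`, `integral_mul_cexp_neg_mul_sq`);
route items 13079, 0768 BY NAME; kit `j009436` (ideator's Monte Carlo of (α), (β)); Resibois1978
(doi:10.1007/bf01011771), VanbeijerenErnst1973, MareschalBlawzdziewiczPiasecki1984 (PRL 52, 1169), Piasecki1987,
GarridoGoldsteinLebowitz2004, ChapmanCowling1970 §16.4, Soto2016 §4.8.1. -/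
def Stubs.stub_offset : Prop :=
    EvenStressEnskog → CollisionTightness → HsEosLowDensity → SStatement → MaxwellisationStatement →
    ∃ η₀ : ℝ, 0 < η₀ ∧ ∀ (a₀ θ₀ : T3 → ℝ) (u₀ : T3 → V3), Continuous a₀ → Continuous θ₀ → Continuous u₀ →
      (∀ x, 0 < a₀ x) → (∀ x, 0 < θ₀ x) → ∃ σ₀ : ℝ, 0 < σ₀ ∧ ∀ σ : ℝ, 0 < σ → σ < σ₀ →
      ∀ Φ : (N : ℕ) → HardSphereFlow (Torus.geometry (Fin 3)) (hsDiameter σ N) (N + 1),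
      ∀ τ : ℝ, 0 < τ → ∀ φ : ℝ → T3 → ℝ, Literature.Analysis.FunctionSpaces.Torus.IsSmoothSpaceTimeOn Set.univ φ →
      (∃ τ' : ℝ, τ' < τ ∧ ∀ s, τ' ≤ s → ∀ x, φ s x = 0) →
      ∀ η₁ ρ₁ θ₁ E₁ : ℝ, 0 < η₁ → η₁ ≤ η₀ → 0 < ρ₁ → 0 < θ₁ → 0 < E₁ →
      ∀ η δ : ℝ, 0 < η → 0 < δ → ∃ r₀ : ℝ, 0 < r₀ ∧ ∀ r ϑ : ℝ, 0 < r → r < r₀ → 0 < ϑ → ϑ < r₀ →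
      ∃ N₀ : ℕ, ∀ N : ℕ, N₀ ≤ N →
        localGibbsLaw σ a₀ u₀ θ₀ N (Φ N)
            ({z | η < |(P2 σ N (Φ N) τ r ϑ φ z - P1 σ N (Φ N) τ r ϑ φ z) +
                confFunctional σ r τ φ (Φ N) z + initConf σ r φ (Φ N) z|} ∩
              {z | Regular σ r τ η₁ ρ₁ θ₁ E₁ (Φ N) z})
          ≤ ENNReal.ofReal δ

/-- Registered stub O (`Stubs.stub_offset`, verbatim): the `sorry` to be discharged. -/
theorem stub_offset :
    EvenStressEnskog → CollisionTightness → HsEosLowDensity → SStatement → MaxwellisationStatement →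
    ∃ η₀ : ℝ, 0 < η₀ ∧ ∀ (a₀ θ₀ : T3 → ℝ) (u₀ : T3 → V3), Continuous a₀ → Continuous θ₀ → Continuous u₀ →
      (∀ x, 0 < a₀ x) → (∀ x, 0 < θ₀ x) → ∃ σ₀ : ℝ, 0 < σ₀ ∧ ∀ σ : ℝ, 0 < σ → σ < σ₀ →
      ∀ Φ : (N : ℕ) → HardSphereFlow (Torus.geometry (Fin 3)) (hsDiameter σ N) (N + 1),
      ∀ τ : ℝ, 0 < τ → ∀ φ : ℝ → T3 → ℝ, Literature.Analysis.FunctionSpaces.Torus.IsSmoothSpaceTimeOn Set.univ φ →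
      (∃ τ' : ℝ, τ' < τ ∧ ∀ s, τ' ≤ s → ∀ x, φ s x = 0) →
      ∀ η₁ ρ₁ θ₁ E₁ : ℝ, 0 < η₁ → η₁ ≤ η₀ → 0 < ρ₁ → 0 < θ₁ → 0 < E₁ →
      ∀ η δ : ℝ, 0 < η → 0 < δ → ∃ r₀ : ℝ, 0 < r₀ ∧ ∀ r ϑ : ℝ, 0 < r → r < r₀ → 0 < ϑ → ϑ < r₀ →
      ∃ N₀ : ℕ, ∀ N : ℕ, N₀ ≤ N →
        localGibbsLaw σ a₀ u₀ θ₀ N (Φ N)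
            ({z | η < |(P2 σ N (Φ N) τ r ϑ φ z - P1 σ N (Φ N) τ r ϑ φ z) +
                confFunctional σ r τ φ (Φ N) z + initConf σ r φ (Φ N) z|} ∩
              {z | Regular σ r τ η₁ ρ₁ θ₁ E₁ (Φ N) z})
          ≤ ENNReal.ofReal δ := by
  sorry

/-- **I · INITIAL MATCHING at `t = 0`** (`stub_init`; the ONLY stub that sees the Euler data and the `t = 0` law
of large numbers — it is where `localSecondLaw_false_without_lln` is honoured).  `HsEosLowDensity →`: Euler frame
of the crux up to the tie (`IsHardSphereEulerSolution σ T ρ u θ`, flows `Φ`, `TendstoHydroFieldsAt … 0`), smooth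
space–time `φ` (only `φ 0` is used): `P(η < |initKin + initConf − ∫ Hs(ρ(0,x),θ(0,x)) φ(0,x) dx|) ≤ δ` for
`r, ϑ < r₀`, `N ≥ N₀`.  Content: static law of large numbers under the local Gibbs law for the two nonlinear but
continuous functionals of the mollified empirical law, `x ↦ h_kin(x) + c₀ρ_r(x)` and `x ↦ ρ_r f_ex(σ³ρ_r)`:
(i) given the positions, the velocities are independent Gaussians, so `hm(x,·) → (ρ̄-weighted r-ball mixture of
Maxwellians) ∗ G_ϑ` and `h_kin + c₀ρ_r → H_id(ρ̄_r, θ̄) + O(r²) + O(ϑ²)` in probability, pointwise in `x` and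
dominated (`Hs_ge`-type bounds); (ii) the density component of `TendstoHydroFieldsAt … 0` with the continuous tests
`b_r(·,x)` identifies `ρ̄_r = b_r ∗ ρ(0,·)` (the TIE — without it the Euler datum decouples, Disproof (a)), and the
energy/momentum components identify `θ̄`; (iii) CONTINUITY of `f_ex` on the band `[0, η₀)` (the antecedent; the
Disproof §(d) shows it is needed already at equilibrium) and of `H_id` on `{ρ ≥ ρ_min > 0, θ ≥ θ_min > 0}` (the Euler
data at `t = 0` are continuous and positive) pass to `r, ϑ → 0`.  Why plausibly true / size: provable now, M/L —
every ingredient is static (`homogeneous_lln_identified`, `localGibbs_lln_holds`, `tendsto_lintegral_rhoC_sub_one`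
are the homogeneous instances in the tree).  Why it might fail: only a frame subtlety — the Euler datum's
`θ(0,·)` must be the limit of the EMPIRICAL temperature (the LLN's energy component), automatic from
`TendstoHydroFieldsAt`; and `σ₀ ≤` the `HsEosLowDensity` band divided by `sup a`-type bounds so that `σ³ρ(0,·)` sits in
the band.  Leans on: tree `TendstoHydroFieldsAt`, `empiricalDensityField`, `localGibbsLaw_preimage_flow_zero`,
`localGibbsMeasure_preimage_pos`, `isProbabilityMeasure_localGibbsLaw`, `Hs`, `hsExcessFreeEnergy_nonneg`,
`hsExcessFreeEnergy_le`, Mathlib `ProbabilityTheory.gaussianReal` entropy algebra; route item 0768 BY NAME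
(proved: `Theorems.hsEosLowDensity_proof`); card `kinetic-supersolution-kn-budget` `InitialMatching`; Spohn1991
I.3, OllaVaradhanYau1993. -/
def Stubs.stub_init : Prop :=
    HsEosLowDensity →
    ∀ (a₀ θ₀ : T3 → ℝ) (u₀ : T3 → V3), Continuous a₀ → Continuous θ₀ → Continuous u₀ →
      (∀ x, 0 < a₀ x) → (∀ x, 0 < θ₀ x) → ∃ σ₀ : ℝ, 0 < σ₀ ∧ ∀ σ : ℝ, 0 < σ → σ < σ₀ →
      ∀ (T : ℝ) (ρ θ : ℝ → T3 → ℝ) (u : ℝ → T3 → V3), IsHardSphereEulerSolution σ T ρ u θ →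
      ∀ Φ : (N : ℕ) → HardSphereFlow (Torus.geometry (Fin 3)) (hsDiameter σ N) (N + 1),
      TendstoHydroFieldsAt (fun N => localGibbsLaw σ a₀ u₀ θ₀ N (Φ N)) Φ ρ u θ 0 →
      ∀ φ : ℝ → T3 → ℝ, Literature.Analysis.FunctionSpaces.Torus.IsSmoothSpaceTimeOn Set.univ φ →
      ∀ η δ : ℝ, 0 < η → 0 < δ → ∃ r₀ : ℝ, 0 < r₀ ∧ ∀ r ϑ : ℝ, 0 < r → r < r₀ → 0 < ϑ → ϑ < r₀ →
      ∃ N₀ : ℕ, ∀ N : ℕ, N₀ ≤ N →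
        localGibbsLaw σ a₀ u₀ θ₀ N (Φ N)
            {z | η < |initKin σ r ϑ φ (Φ N) z + initConf σ r φ (Φ N) z -
                ∫ x : T3, Hs σ (ρ 0 x) (θ 0 x) * φ 0 x|}
          ≤ ENNReal.ofReal δ

/-- Registered stub I (`Stubs.stub_init`, verbatim): the `sorry` to be discharged. -/
theorem stub_init :
    HsEosLowDensity →
    ∀ (a₀ θ₀ : T3 → ℝ) (u₀ : T3 → V3), Continuous a₀ → Continuous θ₀ → Continuous u₀ →
      (∀ x, 0 < a₀ x) → (∀ x, 0 < θ₀ x) → ∃ σ₀ : ℝ, 0 < σ₀ ∧ ∀ σ : ℝ, 0 < σ → σ < σ₀ →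
      ∀ (T : ℝ) (ρ θ : ℝ → T3 → ℝ) (u : ℝ → T3 → V3), IsHardSphereEulerSolution σ T ρ u θ →
      ∀ Φ : (N : ℕ) → HardSphereFlow (Torus.geometry (Fin 3)) (hsDiameter σ N) (N + 1),
      TendstoHydroFieldsAt (fun N => localGibbsLaw σ a₀ u₀ θ₀ N (Φ N)) Φ ρ u θ 0 →
      ∀ φ : ℝ → T3 → ℝ, Literature.Analysis.FunctionSpaces.Torus.IsSmoothSpaceTimeOn Set.univ φ →
      ∀ η δ : ℝ, 0 < η → 0 < δ → ∃ r₀ : ℝ, 0 < r₀ ∧ ∀ r ϑ : ℝ, 0 < r → r < r₀ → 0 < ϑ → ϑ < r₀ →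
      ∃ N₀ : ℕ, ∀ N : ℕ, N₀ ≤ N →
        localGibbsLaw σ a₀ u₀ θ₀ N (Φ N)
            {z | η < |initKin σ r ϑ φ (Φ N) z + initConf σ r φ (Φ N) z -
                ∫ x : T3, Hs σ (ρ 0 x) (θ 0 x) * φ 0 x|}
          ≤ ENNReal.ofReal δ := by
  sorry

/-! ## The composition (kernel-checked, sorry-free): the seven stubs and cruxes 2, 3, 4 imply the crux BY NAME -/

/-- **`LocalSecondLaw` from cruxes 2–4 (+ supports 13085, 13086, 0768) and the seven registered stubs.**  Pure
quantifier bookkeeping plus one real-arithmetic step: `η₁ := min ηK ηO` is the band level handed to R; `σ₀ := min`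
of the five profile thresholds (R, K, S, O, I); after `τ`, R supplies the floors `ρ₁ θ₁ E₁`; K, S, O, I are run at
accuracy `(η/4, δ/5)` and R at `δ/5`; `r₀ := min` of five, and for `r < r₀` the internal velocity scale is
`ϑ := r₀/2`; `N₀ := max` of five; the crux event is `change`d to
`{z | entropyFunctional σ r τ φ (Φ N) z + ∫ Hs(ρ 0 x)(θ 0 x) φ 0 x < −η}` (definitional), `entropyFunctional =
kinFunctional + confFunctional` by `sub_add_cancel`, and on `Regular` the four good inequalities sum to `≥ −η`
(`linarith`), so the event lies in `{¬Regular} ∪ (K-bad ∩ Regular) ∪ (S-bad ∩ Regular) ∪ (O-bad ∩ Regular) ∪ I-bad`;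
`measure_mono`, `measure_union_le`, `ENNReal.ofReal_add`. -/
theorem LocalSecondLaw_of (h₂ : OddContactSymmetry) (h₃ : EvenStressEnskog) (h₄ : RateFloor)
    (s₃ : CollisionTightness) (s₄ : EmpiricalEnskogIdentity) (s₆ : HsEosLowDensity)
    (hR : Stubs.stub_floors) (hM : Stubs.stub_maxwellisation) (hK : Stubs.stub_kineticBalance)
    (hS : Stubs.stub_netProduction) (hT : Stubs.stub_sTransfer) (hO : Stubs.stub_offset)
    (hI : Stubs.stub_init) : LocalSecondLaw := by
  have HM : MaxwellisationStatement := hM h₂ h₄ s₃ s₄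
  have HT : SStatement := hT
  obtain ⟨ηK, hηK, HK⟩ := hK s₃ HM
  obtain ⟨ηO, hηO, HO⟩ := hO h₃ s₃ s₆ HT HM
  have HI := hI s₆
  have hη₁ : 0 < min ηK ηO := lt_min hηK hηO
  have hη₁K : min ηK ηO ≤ ηK := min_le_left _ _
  have hη₁O : min ηK ηO ≤ ηO := min_le_right _ _
  have HR := hR (min ηK ηO) hη₁
  intro a₀ θ₀ u₀ ha hθ hu ha0 hθ0
  obtain ⟨σR, hσR, HR⟩ := HR a₀ θ₀ u₀ ha hθ hu ha0 hθ0
  obtain ⟨σK, hσK, HK⟩ := HK a₀ θ₀ u₀ ha hθ hu ha0 hθ0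
  obtain ⟨σS, hσS, HS⟩ := hS s₃ a₀ θ₀ u₀ ha hθ hu ha0 hθ0
  obtain ⟨σO, hσO, HO⟩ := HO a₀ θ₀ u₀ ha hθ hu ha0 hθ0
  obtain ⟨σI, hσI, HI⟩ := HI a₀ θ₀ u₀ ha hθ hu ha0 hθ0
  refine ⟨min (min (min σR σK) (min σS σO)) σI,
    lt_min (lt_min (lt_min hσR hσK) (lt_min hσS hσO)) hσI, ?_⟩
  intro σ hσ hσlt T ρ θ u hE Φ h0 hT τ hτ φ hφ hφ0 hsupp η δ hη hδ
  have hσ4 : σ < min (min σR σK) (min σS σO) := lt_of_lt_of_le hσlt (min_le_left _ _)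
  have hσR' : σ < σR := lt_of_lt_of_le hσ4 ((min_le_left _ _).trans (min_le_left _ _))
  have hσK' : σ < σK := lt_of_lt_of_le hσ4 ((min_le_left _ _).trans (min_le_right _ _))
  have hσS' : σ < σS := lt_of_lt_of_le hσ4 ((min_le_right _ _).trans (min_le_left _ _))
  have hσO' : σ < σO := lt_of_lt_of_le hσ4 ((min_le_right _ _).trans (min_le_right _ _))
  have hσI' : σ < σI := lt_of_lt_of_le hσlt (min_le_right _ _)
  -- floors from R, after τ
  obtain ⟨ρ₁, θ₁, E₁, hρ₁, hθ₁, hE₁, HR⟩ := HR σ hσ hσR' Φ τ hτ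
  have hη4 : 0 < η / 4 := by positivity
  have hδ5 : 0 < δ / 5 := by positivity
  obtain ⟨rR, hrR, HR⟩ := HR (δ / 5) hδ5
  obtain ⟨rK, hrK, HK⟩ := HK σ hσ hσK' Φ τ hτ φ hφ hφ0 hsupp (min ηK ηO) ρ₁ θ₁ E₁ hη₁ hη₁K hρ₁ hθ₁ hE₁
    (η / 4) (δ / 5) hη4 hδ5
  obtain ⟨rS, hrS, HS⟩ := HS σ hσ hσS' Φ τ hτ φ hφ hφ0 (min ηK ηO) ρ₁ θ₁ E₁ hη₁ hρ₁ hθ₁ hE₁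
    (η / 4) (δ / 5) hη4 hδ5
  obtain ⟨rO, hrO, HO⟩ := HO σ hσ hσO' Φ τ hτ φ hφ hsupp (min ηK ηO) ρ₁ θ₁ E₁ hη₁ hη₁O hρ₁ hθ₁ hE₁
    (η / 4) (δ / 5) hη4 hδ5
  obtain ⟨rI, hrI, HI⟩ := HI σ hσ hσI' T ρ θ u hE Φ h0 φ hφ (η / 4) (δ / 5) hη4 hδ5
  have hr₀ : 0 < min (min (min rR rK) (min rS rO)) rI := lt_min (lt_min (lt_min hrR hrK) (lt_min hrS hrO)) hrI
  refine ⟨min (min (min rR rK) (min rS rO)) rI, hr₀, ?_⟩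
  intro r hr hrlt
  have hr4 : r < min (min rR rK) (min rS rO) := lt_of_lt_of_le hrlt (min_le_left _ _)
  have hrR' : r < rR := lt_of_lt_of_le hr4 ((min_le_left _ _).trans (min_le_left _ _))
  have hrK' : r < rK := lt_of_lt_of_le hr4 ((min_le_left _ _).trans (min_le_right _ _))
  have hrS' : r < rS := lt_of_lt_of_le hr4 ((min_le_right _ _).trans (min_le_left _ _))
  have hrO' : r < rO := lt_of_lt_of_le hr4 ((min_le_right _ _).trans (min_le_right _ _))
  have hrI' : r < rI := lt_of_lt_of_le hrlt (min_le_right _ _)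
  -- the internal velocity-mollification scale (the crux has none): any `0 < ϑ < r₀` will do
  obtain ⟨ϑ, hϑ, hϑlt⟩ : ∃ ϑ : ℝ, 0 < ϑ ∧ ϑ < min (min (min rR rK) (min rS rO)) rI :=
    ⟨min (min (min rR rK) (min rS rO)) rI / 2, by positivity, by linarith⟩
  have hϑ4 : ϑ < min (min rR rK) (min rS rO) := lt_of_lt_of_le hϑlt (min_le_left _ _)
  have hϑK : ϑ < rK := lt_of_lt_of_le hϑ4 ((min_le_left _ _).trans (min_le_right _ _))
  have hϑS : ϑ < rS := lt_of_lt_of_le hϑ4 ((min_le_right _ _).trans (min_le_left _ _))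
  have hϑO : ϑ < rO := lt_of_lt_of_le hϑ4 ((min_le_right _ _).trans (min_le_right _ _))
  have hϑI : ϑ < rI := lt_of_lt_of_le hϑlt (min_le_right _ _)
  obtain ⟨NR, HR⟩ := HR r hr hrR'
  obtain ⟨NK, HK⟩ := HK r ϑ hr hrK' hϑ hϑK
  obtain ⟨NS, HS⟩ := HS r ϑ hr hrS' hϑ hϑS
  obtain ⟨NO, HO⟩ := HO r ϑ hr hrO' hϑ hϑO
  obtain ⟨NI, HI⟩ := HI r ϑ hr hrI' hϑ hϑI
  refine ⟨max (max (max NR NK) (max NS NO)) NI, fun N hN => ?_⟩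
  have hN4 : max (max NR NK) (max NS NO) ≤ N := (le_max_left _ _).trans hN
  have hNR : NR ≤ N := ((le_max_left _ _).trans (le_max_left _ _)).trans hN4
  have hNK : NK ≤ N := ((le_max_right _ _).trans (le_max_left _ _)).trans hN4
  have hNS : NS ≤ N := ((le_max_left _ _).trans (le_max_right _ _)).trans hN4
  have hNO : NO ≤ N := ((le_max_right _ _).trans (le_max_right _ _)).trans hN4
  have hNI : NI ≤ N := (le_max_right _ _).trans hN
  have ER := HR N hNR
  have EK := HK N hNK
  have ES := HS N hNS
  have EO := HO N hNO
  have EI := HI N hNI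
  -- the crux event, through the named functional (definitional)
  change localGibbsLaw σ a₀ u₀ θ₀ N (Φ N)
      {z | entropyFunctional σ r τ φ (Φ N) z + ∫ x : T3, Hs σ (ρ 0 x) (θ 0 x) * φ 0 x < -η}
      ≤ ENNReal.ofReal δ
  set P := localGibbsLaw σ a₀ u₀ θ₀ N (Φ N) with hP
  set IE : ℝ := ∫ x : T3, Hs σ (ρ 0 x) (θ 0 x) * φ 0 x with hIE
  set Reg : Set (Config (N + 1) (Fin 3) T3) := {z | Regular σ r τ (min ηK ηO) ρ₁ θ₁ E₁ (Φ N) z} with hReg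
  set AK : Set (Config (N + 1) (Fin 3) T3) :=
    {z | kinFunctional σ r τ φ (Φ N) z + initKin σ r ϑ φ (Φ N) z - P2 σ N (Φ N) τ r ϑ φ z < -(η / 4)}
    with hAK
  set AS : Set (Config (N + 1) (Fin 3) T3) := {z | P1 σ N (Φ N) τ r ϑ φ z < -(η / 4)} with hAS
  set AO : Set (Config (N + 1) (Fin 3) T3) :=
    {z | η / 4 < |(P2 σ N (Φ N) τ r ϑ φ z - P1 σ N (Φ N) τ r ϑ φ z) +
        confFunctional σ r τ φ (Φ N) z + initConf σ r φ (Φ N) z|} with hAO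
  set AI : Set (Config (N + 1) (Fin 3) T3) :=
    {z | η / 4 < |initKin σ r ϑ φ (Φ N) z + initConf σ r φ (Φ N) z - IE|} with hAI
  have ER' : P {z | ¬ Regular σ r τ (min ηK ηO) ρ₁ θ₁ E₁ (Φ N) z} ≤ ENNReal.ofReal (δ / 5) := ER
  have EK' : P (AK ∩ Reg) ≤ ENNReal.ofReal (δ / 5) := EK
  have ES' : P (AS ∩ Reg) ≤ ENNReal.ofReal (δ / 5) := ES
  have EO' : P (AO ∩ Reg) ≤ ENNReal.ofReal (δ / 5) := EO
  have EI' : P AI ≤ ENNReal.ofReal (δ / 5) := EI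
  have hsub : {z | entropyFunctional σ r τ φ (Φ N) z + IE < -η} ⊆
      ((({z | ¬ Regular σ r τ (min ηK ηO) ρ₁ θ₁ E₁ (Φ N) z} ∪ (AK ∩ Reg)) ∪ (AS ∩ Reg)) ∪ (AO ∩ Reg)) ∪ AI := by
    intro z hz
    have hz' : entropyFunctional σ r τ φ (Φ N) z + IE < -η := hz
    by_cases hreg : Regular σ r τ (min ηK ηO) ρ₁ θ₁ E₁ (Φ N) z
    swap
    · exact Or.inl (Or.inl (Or.inl (Or.inl hreg)))
    have hregm : z ∈ Reg := hreg
    by_cases hk : kinFunctional σ r τ φ (Φ N) z + initKin σ r ϑ φ (Φ N) z - P2 σ N (Φ N) τ r ϑ φ z < -(η / 4)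
    · exact Or.inl (Or.inl (Or.inl (Or.inr ⟨hk, hregm⟩)))
    by_cases hs : P1 σ N (Φ N) τ r ϑ φ z < -(η / 4)
    · exact Or.inl (Or.inl (Or.inr ⟨hs, hregm⟩))
    by_cases ho : η / 4 < |(P2 σ N (Φ N) τ r ϑ φ z - P1 σ N (Φ N) τ r ϑ φ z) +
        confFunctional σ r τ φ (Φ N) z + initConf σ r φ (Φ N) z|
    · exact Or.inl (Or.inr ⟨ho, hregm⟩)
    by_cases hi : η / 4 < |initKin σ r ϑ φ (Φ N) z + initConf σ r φ (Φ N) z - IE|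
    · exact Or.inr hi
    exfalso
    push_neg at hk hs ho hi
    rw [abs_le] at ho hi
    have hsplit : entropyFunctional σ r τ φ (Φ N) z =
        kinFunctional σ r τ φ (Φ N) z + confFunctional σ r τ φ (Φ N) z := by
      simp only [kinFunctional, sub_add_cancel]
    rw [hsplit] at hz'
    linarith [ho.1, ho.2, hi.1, hi.2]
  calc P {z | entropyFunctional σ r τ φ (Φ N) z + IE < -η}
      ≤ P (((({z | ¬ Regular σ r τ (min ηK ηO) ρ₁ θ₁ E₁ (Φ N) z} ∪ (AK ∩ Reg)) ∪ (AS ∩ Reg)) ∪ (AO ∩ Reg)) ∪ AI) :=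
        measure_mono hsub
    _ ≤ P ((({z | ¬ Regular σ r τ (min ηK ηO) ρ₁ θ₁ E₁ (Φ N) z} ∪ (AK ∩ Reg)) ∪ (AS ∩ Reg)) ∪ (AO ∩ Reg)) + P AI :=
        measure_union_le _ _
    _ ≤ (P (({z | ¬ Regular σ r τ (min ηK ηO) ρ₁ θ₁ E₁ (Φ N) z} ∪ (AK ∩ Reg)) ∪ (AS ∩ Reg)) + P (AO ∩ Reg)) + P AI :=
        add_le_add (measure_union_le _ _) le_rfl
    _ ≤ ((P ({z | ¬ Regular σ r τ (min ηK ηO) ρ₁ θ₁ E₁ (Φ N) z} ∪ (AK ∩ Reg)) + P (AS ∩ Reg)) + P (AO ∩ Reg)) + P AI :=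
        add_le_add (add_le_add (measure_union_le _ _) le_rfl) le_rfl
    _ ≤ (((P {z | ¬ Regular σ r τ (min ηK ηO) ρ₁ θ₁ E₁ (Φ N) z} + P (AK ∩ Reg)) + P (AS ∩ Reg)) + P (AO ∩ Reg)) + P AI :=
        add_le_add (add_le_add (add_le_add (measure_union_le _ _) le_rfl) le_rfl) le_rfl
    _ ≤ (((ENNReal.ofReal (δ / 5) + ENNReal.ofReal (δ / 5)) + ENNReal.ofReal (δ / 5)) + ENNReal.ofReal (δ / 5)) +
          ENNReal.ofReal (δ / 5) :=
        add_le_add (add_le_add (add_le_add (add_le_add ER' EK') ES') EO') EI'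
    _ = ENNReal.ofReal δ := by
        rw [← ENNReal.ofReal_add hδ5.le hδ5.le, ← ENNReal.ofReal_add (by positivity) hδ5.le,
          ← ENNReal.ofReal_add (by positivity) hδ5.le, ← ENNReal.ofReal_add (by positivity) hδ5.le]
        congr 1
        ring

/-- Wiring check: the registered stubs feed `LocalSecondLaw_of` exactly as stated (an `example`, so that the
composition stays the file's first theorem concluding the crux). -/
example (h₂ : OddContactSymmetry) (h₃ : EvenStressEnskog) (h₄ : RateFloor) (s₃ : CollisionTightness)
    (s₄ : EmpiricalEnskogIdentity) (s₆ : HsEosLowDensity) : LocalSecondLaw :=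
  LocalSecondLaw_of h₂ h₃ h₄ s₃ s₄ s₆ stub_floors stub_maxwellisation stub_kineticBalance stub_netProduction
    stub_sTransfer stub_offset stub_init

/-- **The equation of state is no longer a hypothesis**: `HsEosLowDensity` (stmt-0768) is PROVED in the tree
(`Theorems.hsEosLowDensity_proof`, `Theorems/ImplosionDichotomyHsEosLowDensity.lean`; the route decls
`ImplosionDichotomy.HsEosLowDensity` and `JParityClosure.HsEosLowDensity` have identical bodies), so the line
reads: cruxes 2, 3, 4 + supports 13085, 13086 + the seven stubs ⇒ crux 5. -/
theorem LocalSecondLaw_of' (h₂ : OddContactSymmetry) (h₃ : EvenStressEnskog) (h₄ : RateFloor)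
    (s₃ : CollisionTightness) (s₄ : EmpiricalEnskogIdentity)
    (hR : Stubs.stub_floors) (hM : Stubs.stub_maxwellisation) (hK : Stubs.stub_kineticBalance)
    (hS : Stubs.stub_netProduction) (hT : Stubs.stub_sTransfer) (hO : Stubs.stub_offset)
    (hI : Stubs.stub_init) : LocalSecondLaw :=
  LocalSecondLaw_of h₂ h₃ h₄ s₃ s₄ Summit.AtomisticToContinuum.HydrodynamicLimit.Theorems.hsEosLowDensity_proof
    hR hM hK hS hT hO hI

/-! ## Checks against the landed `Negative/*` lemmas (imported above; all `example`s) -/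

/-- LOAD-BEARING MAP honoured: the crux WITHOUT the `t = 0` LLN and the crux WITHOUT the time-support condition are
FALSE (landed).  In this line the LLN is a hypothesis of `stub_init` only (threaded as `h0`), and the support
condition is a hypothesis of `stub_kineticBalance` and `stub_offset` (threaded as `hsupp`). -/
example : ¬ LocalSecondLawWithoutLLN := localSecondLaw_false_without_lln
example : ¬ LocalSecondLawWithoutSupport := localSecondLaw_false_without_support

/-- TIGHTNESS honoured: no positive gap can be produced (landed); every stub is `η`-approximate and vanishes
separately at global equilibrium. -/
example {c : ℝ} (hc : 0 < c) : ¬ LocalSecondLawGapAt c := not_localSecondLawGapAt hc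
example : ¬ LocalSecondLawStrictGap := not_localSecondLawStrictGap

/-- LIMIT ORDER honoured: `∃ r₀` after `∀ N` is FALSE (landed, boundary-term decided); every stub keeps
`∃ r₀ ∀ r ϑ < r₀ ∃ N₀ ∀ N ≥ N₀`. -/
example : ¬ LocalSecondLawRAfterN := not_localSecondLawRAfterN

/-- VOCABULARY BRIDGE (`rfl`): the cone density of this file's vocabulary IS the tree's `mollDensity` of
`EvenCollisionTubeFunctional.lean` (so `Regular`'s band and the cutoff `g(σ³ρ_r)` of cruxes 2–4 / Θ speak about
the same field). -/
example (r : ℝ) (z : Config (N + 1) (Fin 3) T3) (x₀ : T3) : rhoC r z x₀ = mollDensity r z x₀ := rfl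

end Summit.AtomisticToContinuum.HydrodynamicLimit.Cruxes.LocalSecondLaw.ResiboisOffsetIdentity

end
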